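import Mathlib
import Literature.MathematicalPhysics.QuantumFieldTheory.Balaban1983to89.B10Eq28RegularTube

/-
Copyright: publication-cell `pub-balaban` (b2b), seat b2b-balaban-b10 gen 31 (v1).  Literature leaf — `SU(N) ⊂ M_N(ℂ)`,
elementary C⋆-algebra identities and estimates (`Ring.inverse`, telescoping, the exponential), the topology of finitely
many matrix variables, and applications of the cell's landed theorems only (`…B10Eq28RegularTube` (gen 30) and, through
it, `…B10Eq26SuSlice`, `…B10Eq32RegularSuN`, `…B10Eq32AxialSuN`, `…B10Eq26SiteGauge`, `…B10Eq29TubeLine`,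
`…B10Eq61Leaves`, `…B10Eq61PerSite`, `…B10Eq27AxialLog`, `…B13Inv214Orbit`, `…B13Inv214OrbitSUN`, `…B7Prop1Explicit`,
`…B7Prop1Local`, `…B7Prop2SpecialUnitary`, `Literature.Analysis.Calculus.ExpDuhamel`, all imported BY NAME, nothing
edited); every theorem is kernel-proved and tagged [folklore] or [cite: …] (a LOCATED printed shape); the objects are
MODEL OBJECTS (functions of finitely many matrix variables), never asserted to be Bałaban's; NO new cited facts, NO
summit vocabulary.
-/

/-!
# `Balaban1983to89.B10Eq28CplxRegTube` — [Balaban1987RG1] (1.14) p. 262, condition (iii) `|∂𝐔 − 1| < α₀ξ²` on the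
# COMPLEX configuration `𝐔 = U′U` itself: the lineage's model of [I]'s analyticity space completed to ALL THREE of its
# conditions on `𝐔`, the plaquette variable WITH INVERSES (`U(x, x′) = U⁻¹(x′, x)`) of a non-unitary configuration,
# and the `SU(N)` joint theorem ((26) ⇒ (29), (31) ⇒ (32), the strip engine) with holomorphy assumed ONLY there

T. Bałaban, *Renormalization group approach to lattice gauge field theories. I. Generation of effective actions in a
small field approximation and a coupling constant renormalization in four dimensions*, Commun. Math. Phys. **109**,
249–301 (1987) [Balaban1987RG1] = [I] (cell paper B12; PDF `paper:balaban1987-cmp109-rg-i-small-field`, journal page =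
PDF page + 248); T. Bałaban, *Ultraviolet stability of three-dimensional lattice pure gauge field theories*, Commun.
Math. Phys. **102**, 255–275 (1985) [Balaban1985UV3] (cell paper B10; PDF `paper:balaban1985-cmp102-uv-stability-3d`,
journal page = PDF page + 254); T. Bałaban, *Averaging operations for lattice gauge theories*, Commun. Math. Phys.
**98**, 17–51 (1985) [Balaban1985Averaging] (cell paper B7); T. Bałaban, *Propagators for lattice gauge theories in a
background field*, Commun. Math. Phys. **99**, 389–434 (1985) [Balaban1985BackgroundPropagators] (= [13] of [I]).

CITATION HEADER (lean-in-tree rule).  The passages marked «q013», «q014», «q015» ([I]) and «p009», «p010» (B10) below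
were READ AS IMAGE for this module from the renders (directory `b2b-balaban-ref1/pages/1987-cmp109-rg-I-small-field/`)
`1987-cmp109-rg-I-small-field-p0NN-x2.png`, NN = 13 (journal p. 261: (1.8), `Im U = (1/2i)(U − U⁻¹)`, the extension
to `Gᶜ`-valued configurations), 14 (p. 262: (1.10)–(1.16), the space `Uᶜⱼ(X, α₀, α₁, γ₀)` and its four conditions),
15 (p. 263: the remarks on the definition, the analyticity of `𝐄⁽ʲ⁾` on `Uᶜⱼ(X, α₀, α₁)` with ABSOLUTE constants,
(1.19), the gauge invariance of the spaces), and (directory `b2b-balaban-ref1/pages/1985-cmp102-uv-stability-3d/`)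
`1985-cmp102-uv-stability-3d-pNNN-x2.png`, NNN = 009 (journal p. 263: the three properties of `𝒫′₁`, (27)–(29), the
smallness (28) and its sentence), 010 (p. 264: (31), (32), *"(26) holds for all regular gauge field configurations"*).
The passages marked «r018» ([Balaban1985Averaging] p. 18: bonds, (7)–(9)) and «s396» ([Balaban1985BackgroundPropagators]
pp. 396–397: the `Gᶜ`-valued classes (3.35)–(3.38)) were read from the cell's materialised texts
`paper:balaban1985-cmp98-averaging` (PDF p. 2) and `paper:balaban1985-cmp99-background-propagators` (PDF pp. 8–9).
This module adds NO cited fact; the manuscripts under audit are quoted for the SHAPES of hypotheses and definitions,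
never cited for a disputed step.  Siblings used BY NAME (byte-identical, nothing edited): `…B10Eq28RegularTube` (b10
gen 30: `RegTube`, `mem_regTube_of_mem_regSU`, `exp_mul_mem_regTube`, `regTube_subset_tubeCfg`, `regTube_mono`,
`regTube_mem_nhds`, `regTube_mem_nhds_one`, `expLine_mem_regTube`, `gaugeAct_mem_regTube`,
`differentiableAt_comp_expChart_zero_of_mem_nhds`, `derivZeroAlongV_of_suInvariantNear_of_differentiableAt`,
`located26_strictly_weaker_on_regTube`, `exists_windows`, `norm_mul_le_of_norm_le_one_left`; its joint theorem
`logHalfBound_sub_box_of_regTube` only in a compile-time `example`), `…B10Eq32RegularSuN` (b10 gen 28: `regSU`,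
`one_mem_regSU`, `conjInvNear_of_orbitConstOnIn_regSU`, `eq29_axialBox_reg`, `plaqIn_bonds`, `inBox_sq_zero`,
`inBox_sq_e`, `inBox_sq_ee`, `norm_exp_thetaN_sub_one_pos`), `…B10Eq32AxialSuN` (b10 gen 27: `BoxBond`, `boxEnds`,
`extCfg`, `extCfg_coe`, `extCfg_of_not`, `extCfg_mem`, `gaugeAct_boxEnds`, `axialGenBox`, `axialGenBox_mem_skewAdjoint`,
`norm_axialGenBox_le`, `trace_axialGenBox_eq_zero`), `…B10Eq26SiteGauge` (b10 gen 25: `norm_le_one_of_mem_unitary`,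
`diffAlongV_eq_sub`, `logHalfBound_congr`, `inverse_exp_mul_unitary`, `norm_exp_mul_sub_le`), `…B10Eq29TubeLine` (b10
gen 23: `cstarAlgebraMatrix`, `TubeCfg`, `expLine`, `abs_im_mul_norm_lt_of_mem_rect`, `analyticOnStrip_expLine`),
`…B10Eq61PerSite` (b10: `Rect`, `mem_rect`, `LineInStrip`, `AnalyticOnStrip`, `DerivZeroAlongV`,
`logHalfBound_diffAlongV_of_derivZero`, `inv_halfWidth_le`, `B13.LogHalfBound`), `…B10Eq27AxialLog` (b10 gen 26:
`plaq`, `latEnds`), `…B13Inv214Orbit` (b13: `gaugeAct` — print's (1.10) with `Ring.inverse` —, `gaugeAct_eq_star`,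
`isUnit_of_mem_unitary`, `inverse_eq_star_of_mem_unitary`), `…B13Inv214OrbitSUN` (b13 gen 22: `OrbitConstOnIn`,
`SiteGaugeInvSU`), `…B7Prop1Explicit` (b07: `Site`, `e`, `l1`), `…B7Prop1Local` (b07: `InBox`, `PlaqIn`),
`…B7Prop2SpecialUnitary` (b07: `specialUnitaryUnits`, `thetaN`), `Literature.Analysis.Calculus.ExpDuhamel`
(`norm_exp_sub_one_le`).

WHY THIS MODULE (the open edge it closes, by name).  `…B10Eq28RegularTube` (gen 30) LOCATED the lineage's holomorphy
hypothesis on the REGULAR TUBE `RegTube N lo hi a α′` = the configurations `V_b = exp(B_b)·U_b`, `‖B_b‖ < a`, `U ∈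
regSU N lo hi α′` — the shape of conditions (i) (1.11) and (ii) (1.13) of [I]'s space `Uᶜⱼ(X, α₀, α₁)` («q014») — and
named in its HONEST SCOPE (ii) what it does NOT model: *"condition (iii) (1.14), `|∂𝐔 − 1| < α₀ξ²` for the COMPLEX
configuration itself … Condition (iii) is an open condition holding at `1`, dischargeable along the strip by the same
smallness; adding it is the next edge."*  THIS MODULE adds it.  §1 defines THE PLAQUETTE VARIABLE WITH INVERSES
`plaqInv φ x κ μ = φ(x,κ)·φ(x+e_κ,μ)·φ(x+e_μ,κ)⁻¹·φ(x,μ)⁻¹` of an ARBITRARY configuration (`Ring.inverse`): print's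
`∂𝐔` for `Gᶜ`-valued `𝐔` reads the reversed bonds of `∂p` through `U(x, x′) = U⁻¹(x′, x)` («r018» (7), (9)), which
off the unitaries is the INVERSE, not the adjoint of gen 26's `plaq` (the two agree on unitary-valued configurations,
`plaqInv_eq_plaq`; [I] itself computes with `U⁻¹` for complex `U`: «q013» `Im U = (1/2i)(U − U⁻¹)`), proves its
covariance `φᵘ(∂p) = u(x)·φ(∂p)·u(x)⁻¹` under the UNITS-valued site transformations of (1.10) («q014»: `Gᶜ`-valued
`u`, b13's `gaugeAct`) and the elementary estimate: a tube point `exp(B)·U` over a unitary-valued `U` with `‖B_b‖ ≤ β`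
has `plaqInv` within `e^{4β} − 1` of `plaq U` (its bonds move by `≤ e^β − 1`, and so do their INVERSES `U_b⋆exp(−B_b)`;
telescoping among non-contractive factors).  §2 defines CONDITION (iii) `RegCplx lo hi α″` = {every plaquette in the box
has `‖plaqInv − 1‖ ≤ α″`} and THE COMPLEX-REGULAR TUBE `CplxRegTube N lo hi a α′ α″ = RegTube N lo hi a α′ ∩ RegCplx lo
hi α″` — [I]'s space in all three conditions on `𝐔` (print: `α″ = α′ = α₀ξ²`, the SAME constant in (1.11) and (1.14);
the model keeps three windows and never assumes `α′ < α″`) — and proves: it contains `regSU N lo hi α′` when `α′ ≤ α″`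
(«q015»: *"In particular the minimal configurations … satisfy the above conditions"*), it is a NEIGHBOURHOOD of each
regular configuration with window to spare and of the flat one (`Ring.inverse` is continuous on the units; finitely
many plaquettes), it is invariant under the `SU(N)`-valued site transformations («q015»: *"The spaces Uᶜⱼ(X, α₀, α₁)
are, by the definition, gauge invariant also"*), it is MONOTONE in the three windows («q015»: *"then obviously these
three conditions are satisfied in the original formulation"*), and THE BRACKET: (i)–(ii) imply (iii) with window `α′ +
(e^{4a} − 1)` (`cplxRegTube_eq_regTube`: no cut for `α″ ≥ α′ + e^{4a} − 1`; print's remark of this shape for its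
gauge-potential classes, «s396»: *"if U′U satisfies the conditions (3.37), (3.38), then it satisfies also (3.35),
(3.36) with α₀ replaced by O(1)(α₀ + α₁)"*), while §5 shows the cut is PROPER for `α″ < e^a − 1` — in particular in
print's regime `α″ = α′ < e^a − 1`.  §3 proves THE POINT for the engine: the strip curve `ζ ↦ exp(ζ·H)·1` of a small
skew-Hermitian traceless generator satisfies (iii) too, `‖plaqInv − 1‖ ≤ e^{4(ρ + 2a)} − 1` on `Rect (a/κ)` (`‖H_b‖ ≤
ρ`, `‖H_b‖ ≤ κ`), so B10's smallness (28) («p009»: *"and for g₀ sufficiently small the number on the right-hand side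
above is small"*) discharges (iii) along (29) exactly as it discharged (i) in gen 30.  §4 is the LOCATED JOINT THEOREM
`logHalfBound_sub_box_of_cplxRegTube`: gen 30's binder list with `RegTube N lo hi a α′ ⊆ sp X` REPLACED by `CplxRegTube
N lo hi a α′ α″ ⊆ sp X` plus ONE more smallness binder `e^{8(R X·α + a)} − 1 ≤ α″`, everything else BY NAME; a numeric
`example` shows the binders jointly satisfiable with ALL windows positive and `α″ = α′`.  §5 are the TEETH: the scalar
dilation `e^t·1` of one bond (`|t| < a`) lies in gen 30's regular tube and violates (iii) once `e^t − 1 > α″`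
(`exists_mem_regTube_not_mem_cplxRegTube`, `cplxRegTube_ssubset_regTube`), and gen 30's strict-weakness witness for
the located (26) survives the restriction (`located26_strictly_weaker_on_cplxRegTube`).

WHAT IS PRINTED (verbatim).
* [I] p. 261 («q013»): *"For example we can extend to Gᶜ-valued configurations satisfying the conditions
  (3.35)–(3.38) [13], and from results of that paper we conclude that these terms are analytic functions of the
  configurations."*; *"where π denotes the projection in the space of all complex N × N-matrices onto the algebra 𝔤ᶜ,
  and Im U = (1/2i)(U − U⁻¹)."*; *"Thus we assume that there are functions 𝐄⁽ʲ⁾(X, g_{j−1}, 𝐔, 𝐉), analytic on a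
  space of regular, complex configurations 𝐔, 𝐉"*.
* [I] p. 262 («q014»): *"The gauge field configuration 𝐔 is defined at bonds of X and has values in Gᶜ, the
  configuration 𝐉 is also defined at bonds of X and has values in 𝔤ᶜ. A Gᶜ-valued gauge transformation u acts on
  pairs (𝐔, 𝐉) in the following way (𝐔, 𝐉)ᵘ = (𝐔ᵘ, R(u)𝐉) = (u₋𝐔u₊⁻¹, R(u₋)𝐉), (1.10) where for a bond b = ⟨b₋, b₊⟩
  we define u±(b) = u(b±). The orbit of the group of Gᶜ-valued gauge transformations determined by a pair (𝐔, 𝐉) is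
  denoted by [(𝐔, 𝐉)]."*; *"The space Uᶜⱼ(X, α₀, α₁, γ₀) is a union of orbits [(𝐔, 𝐉)] determined by configurations
  𝐔, 𝐉 satisfying the four conditions written below. (i) 𝐔 = U′U, U has values in the group G, |∂U − 1| < α₀ξ² on X,
  (1.11)"*; *"(ii) U′ = exp iξA′, A′ has values in the algebra 𝔤ᶜ, |A′|, |∇^ξ_U A′| < α₁ on X. (1.13) (iii) The
  configurations 𝐔, 𝐉 satisfy the bounds |∂𝐔 − 1| < α₀ξ², |𝐉| < γ₀ on X. (1.14)"*; *"The first three conditions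
  (i)–(iii) in the above definition are rather simple and natural, the conditions of this form appeared many times in
  the previous papers, e.g. see (3.35)–(3.38) [13]."*.
* [I] p. 263 («q015»): *"Let us take the space of configurations (𝐔, 𝐉) satisfying the conditions (i)–(iii) with
  constants α′₀, α′₁ instead of α₀, α₁. We assume that the constants α′₀, α′₁ are smaller than α₀, α₁ correspondingly,
  then obviously these three conditions are satisfied in the original formulation."*; *"In particular the minimal
  configurations U_j satisfying the bound |∂U_j − 1| < ε₀ξ² with ε₀ sufficiently small, satisfy the above
  conditions."*; *"We assume that the function 𝐄⁽ʲ⁾(X, g_{j−1}, 𝐔, 𝐉) is defined and analytic on the space Uᶜⱼ(X, α₀,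
  α₁), with some positive, absolute constants α₀, α₁ (i.e., constants independent of X and j)."*; *"We assume that all
  functions 𝐄⁽ʲ⁾(X, g_{j−1}, 𝐔, 𝐉) are gauge invariant with respect to the group of all gauge transformations (1.10).
  Explicitly 𝐄⁽ʲ⁾(X, g_{j−1}, 𝐔ᵘ, R(u)𝐉) = 𝐄⁽ʲ⁾(X, g_{j−1}, 𝐔, 𝐉) (1.19) for all Gᶜ-valued gauge transformations u. The
  spaces Uᶜⱼ(X, α₀, α₁) are, by the definition, gauge invariant also."*.
* B10 p. 263 («p009»): *"The third property is the analyticity with respect to U₁. These properties follow from the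
  results of previous papers"*; *"|B(c)| < 4L²|c₋ − y|g₀p(g₀) < 8L²3R₁M₁r(g₀)g₀p(g₀), (28) and for g₀ sufficiently
  small the number on the right-hand side above is small."*; *"By the gauge invariance (26), we have 𝒫′₁(g₀, X, U₁) =
  𝒫′₁(g₀, X, exp i𝓗(B)), (29)"*.  B10 p. 264 («p010»): *"We have to notice only that (26) holds for all regular
  gauge field configurations, not only for the minimal configurations U₁."*.
* [Balaban1985Averaging] p. 18 («r018»): *"Bonds of the lattice Ω are ordered pairs ⟨x, x′⟩ of nearest neighbor
  points x, x′ of Ω."*; (7): *"U(x, x′) = U⁻¹(x′, x) = U*(x′, x)."*; (8): *"Uᵘ(x, x′) = u(x)U(x, x′)u⁻¹(x′)"*; (9)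
  and *"where the order of factors in the product is the same as the order of bonds in Γ"*, *"For a plaquette p = ⟨x,
  y, z, w⟩ we define ∂p as the oriented contour ∂p = ⟨x, y⟩ ∪ ⟨y, z⟩ ∪ ⟨z, w⟩ ∪ ⟨w, x⟩, and U(∂p) is defined by
  (9)."*.
* [Balaban1985BackgroundPropagators] pp. 396–397 («s396»): *"We have to consider operators extended to configurations
  U with values in the complexified group Gᶜ. We may define regularity conditions for such configurations in the same
  way, i.e. by the conditions (3.35), (3.36). Instead we specify somewhat more the class of configurations considered.
  We assume that they have the form U′U, where U has values in G and U′ = e^{iηA′}, A′ ∈ 𝔤ᶜ."*; *"We will prove in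
  another paper that if U′U satisfies the conditions (3.37), (3.38), then it satisfies also (3.35), (3.36) with α₀
  replaced by O(1)(α₀ + α₁), but we will not use this fact here."*.

THE MATHEMATICS ([folklore]; five remarks).  (M1) INVERSES.  In a unital C⋆-algebra, for units `u, v` and any `a`:
`(u·a·v⁻¹)⁻¹ = v·a⁻¹·u⁻¹` (both sides `0` when `a` is not a unit, with `Ring.inverse`), whence the covariance
`φᵘ(∂p) = u(x)·φ(∂p)·u(x)⁻¹` of the plaquette variable with inverses under (1.10) for EVERY configuration `φ`; for
unitary `u(x)` this is a conjugation by a unitary and `‖φᵘ(∂p) − 1‖ = ‖φ(∂p) − 1‖`: (iii) is a condition on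
`G`-orbits.  (M2) THE TUBE ESTIMATE.  `(exp(B)U)⁻¹ = U⋆exp(−B)` (gen 25), so both `exp(B)U` and its inverse are
within `e^{‖B‖} − 1` of `U`, `U⋆`; telescoping `A₁A₂A₃A₄ − B₁B₂B₃B₄ = Σ B₁⋯(A_i − B_i)⋯A₄` with `‖B_i‖ ≤ 1`, `‖A_i‖ ≤
1 + δ_i` gives `‖A₁A₂A₃A₄ − B₁B₂B₃B₄‖ ≤ Π(1 + δ_i) − 1`; hence `‖plaqInv(exp(B)U) − plaq(U)‖ ≤ e^{4β} − 1` for `‖B_b‖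
≤ β`, and a point of the regular tube has `‖plaqInv − 1‖ ≤ α′ + (e^{4a} − 1)`.  (M3) NEIGHBOURHOODS.  `V ↦
plaqInv(V)(p)` is continuous at every units-valued `V` (`Ring.inverse` is continuous at units), the box has finitely
many plaquettes, so a STRICT (iii) at a units-valued `V₀` propagates to a neighbourhood; with gen 30's
`regTube_mem_nhds` the complex-regular tube is a neighbourhood of each `U ∈ regSU … α′` when `α′ < α″`, and of `1` when
`α″ > 0` — which is all b13's binder (a) at the base point needs (gen 30 §4, BY NAME).  (M4) THE LINE.  For `ζ ∈ Rect
(a/κ)` and `‖H_b‖ ≤ κ`, `‖H_b‖ ≤ ρ`: `‖ζH_b‖ ≤ |Re ζ|‖H_b‖ + |Im ζ|‖H_b‖ ≤ (1 + a/κ)ρ' + a ≤ ρ + 2a` (gen 30's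
arithmetic), so by (M2) with `U ≡ 1` the curve `exp(ζH)·1` satisfies (iii) with window `e^{4(ρ + 2a)} − 1`; with the
lineage's generator (`ρ = 2·R X·α`) the condition reads `e^{8(R X·α + a)} − 1 ≤ α″`.  (M5) TEETH.  `exp(t·1) = e^t·1`
in `M_N(ℂ)`; the configuration `e^t·1` on one bond of the unit square, `1` elsewhere, is `exp(B)·1` with `‖B‖ = |t|`,
so it lies in the regular tube for `|t| < a` (flat base), and its plaquette variable with inverses is `e^t·1`, at
distance `|e^t − 1|` from `1`: for `α″ < e^a − 1` choose `t ∈ (log(1 + α″), a)`.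

HYPOTHESIS SHAPES (never discharged here; each a LOCATED printed shape or a lineage binder BY NAME).  Located
holomorphy `hsp : ∀ X, CplxRegTube N lo hi a α′ α″ ⊆ sp X` with `hE : ∀ X, DifferentiableOn ℂ (E X) (sp X)`, `0 < a`,
`0 < α″` — «q015» *"defined and analytic on the space Uᶜⱼ(X, α₀, α₁)"* in all three conditions (i)–(iii) on `𝐔`
(«q014»), replacing gen 30's `RegTube N lo hi a α′ ⊆ sp X`; the two smallness binders `hsmall : ∀ X, 8·(R X·α) + 4a ≤
α′` (gen 30's, verbatim) and `hsmall2 : ∀ X, e^{8(R X·α + a)} − 1 ≤ α″` (NEW) — «p009» (28) in the model's currency;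
located (26) `h26` — gen 28's verbatim («p010»); every other binder of §4 is gen 30's `logHalfBound_sub_box_of_regTube`,
verbatim and in the same order.  Condition (iii) is typed with `≤ α″` (print: strict `<`), as gen 28's `regSU` types
(1.11)/(13) with `≤ α′`; the strict versions are the interiors used in the neighbourhood statements.

HONEST SCOPE.  (i) As in the whole lineage, `E`, `sp`, `sp′`, the box, `α`, `α′`, `α″`, `a`, `R`, `p`, `q` are MODEL
OBJECTS: nothing here asserts that Bałaban's `𝒫′₁(g₀, X, ·)` or `𝐄⁽ʲ⁾` satisfies the hypotheses, and the constants in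
`hsmall`, `hsmall2` and in the bracket `[e^a − 1, α′ + e^{4a} − 1]` are the model's (crude sufficient conditions:
bondwise closeness ⇒ plaquette closeness), not print's `O(1)(α₀ + α₁)`.  (ii) WHAT IS NOW MODELLED AND WHAT IS STILL
NOT.  Modelled: (i) (1.11) (gen 28's `regSU`, window `α′`), (ii) (1.13) in its `|A′| < α₁` half (fibre coordinate
`‖B_b‖ < a`), (iii) (1.14) in its `|∂𝐔 − 1|` half (`RegCplx`, window `α″`, plaquette variables with inverses, operator
norm, plaquettes INSIDE THE BOX).  NOT modelled: the covariant-derivative half `|∇^ξ_U A′| < α₁` of (1.13); the field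
`𝐉` and its bound `|𝐉| < γ₀` of (1.14) (the lineage's functions have no `𝐉`-variable); condition (iv) (1.15)–(1.16)
(the maximal-domain sequence and the axial-gauge functions `U_n`); the restriction of the fibre coordinate to `𝔤ᶜ =
𝔰𝔩(N, ℂ)` (the lineage's tubes take `B_b ∈ M_N(ℂ)`, so the teeth configuration `e^t·1`, `t ≠ 0`, is a point of the
MODEL's tube that is not `SL(N, ℂ)`-valued — the cut exhibited in §5 is a cut of the model's regular tube; whether
print's (iii) cuts print's own (i)–(ii) at `α″ = α′` is not decided here); and the ORBIT SATURATION: print's space is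
the union of the `Gᶜ`-ORBITS (1.10) of the representatives satisfying (i)–(iv), whereas `CplxRegTube` is the set of
representatives satisfying (i)–(iii) — proved invariant under the `G = SU(N)`-valued site transformations
(`gaugeAct_mem_cplxRegTube`), NOT saturated under `SL(N, ℂ)`-valued ones (a conjugation by a non-unitary unit does not
preserve `‖· − 1‖`; §1's covariance `plaqInv_gaugeAct_of_isUnit` is all that is proved about them).  In these respects
`CplxRegTube ⊆ sp X` still asks holomorphy on a set that is neither contained in nor contains print's space; what it no
longer asks, relative to gen 30, is holomorphy at tube points violating (iii).  The scales/lattice factors `ξ`, `ξ²` of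
print are absorbed in the model's windows.  (iii) FOUR WINDOWS.  Print has `α″ = α′` (`α₀ξ²` in both (1.11) and
(1.14)) and `α₁` independent; the model's binders are consistent with this regime: the numeric `example` of §4 has `α′
= α″ = 1`, `a = 1/64`, `α = 1/(64N)`; the module proves nothing about print's constants.  (iv) `N ≥ 1` (`[NeZero N]`)
in §4–§5; the strict-weakness witness of §5 needs `N ≥ 2` (gen 28's center phase).  Carriers: a box of `ℤ^d` (gen
27's `BoxBond lo hi`), not print's torus; the teeth on the unit square of `ℤ²`.  (v) `RegCplx` and `CplxRegTube` are
NOT asserted open — `RegCplx` is not (`Ring.inverse` vanishes off the units, so non-unit configurations with `α″ ≥ 1`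
belong to it); proved and used: neighbourhood statements at units-valued points with strict room (§2).  (vi) The
teeth threshold: the cut is exhibited for `α″ < e^a − 1` and excluded for `α″ ≥ α′ + e^{4a} − 1`; the gap between is
not resolved, and no cut is exhibited over a NON-flat regular base.  (vii) `U(N)`: not treated (as gens 28–30).
(viii) Gen 30's joint theorem is NOT a corollary of §4 (it has no `α″`-smallness) nor conversely (it assumes more
holomorphy); §4's second `example` records gen 30's BY NAME.

COLLISION MAP.  Gen 26 (`…B10Eq27AxialLog`): `plaq` (adjoints on the reversed bonds) — NEW: `plaqInv` (inverses; `=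
plaq` on unitary-valued configurations, `plaqInv_eq_plaq`); b07's group-level holonomy `B7Prop1Explicit.hol` through
gen 26's `unitCfg` (a `dite` on `IsUnit`, junk unit `1`) is the lineage's other inverse-based plaquette word
(`val_hol_plaqWord`, stated for unitary-valued configurations) — `plaqInv` is the closed formula with `Ring.inverse`
(junk `0`), convenient for the continuity and the estimates of §1–§2.  Gen 28 (`…B10Eq32RegularSuN`):
`plaq_gaugeAct`, `norm_plaq_gaugeAct_sub_one`, `plaq_extCfg_gaugeAct` (unitary-valued `φ` AND `u`) — NEW:
`plaqInv_gaugeAct_of_isUnit` (any `φ`, units-valued `u`), `plaqInv_gaugeAct`, `norm_plaqInv_gaugeAct_sub_one`,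
`plaqInv_extCfg_gaugeAct` (any `φ`, unitary `u`); its `regSU` (condition (i)) — NEW: `RegCplx` (condition (iii)),
`CplxRegTube`.  Gen 30 (`…B10Eq28RegularTube`): `RegTube`, `regTube_mem_nhds(_one)`, `expLine_mem_regTube`,
`lineInStrip_expLine_regTube`, `gaugeAct_mem_regTube`, `derivZeroAlongV_of_suInvariantNear_regTube`,
`logHalfBound_sub_box_of_regTube`, `twistV_not_mem_regTube`, `located26_strictly_weaker_on_regTube` — NEW: the
`CplxRegTube` versions of each (`cplxRegTube_mem_nhds(_one)`, `expLine_mem_cplxRegTube`,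
`lineInStrip_expLine_cplxRegTube`, `gaugeAct_mem_cplxRegTube`, `derivZeroAlongV_of_suInvariantNear_cplxRegTube`,
`logHalfBound_sub_box_of_cplxRegTube`, `located26_strictly_weaker_on_cplxRegTube`) and the cut
(`exists_mem_regTube_not_mem_cplxRegTube`, `cplxRegTube_ssubset_regTube`); its contractive telescoping
`norm_mul4_sub_mul4_le` (bound `Σδ_i`) — NEW: the non-contractive `norm_mul4_sub_mul4_le_prod` (bound `Π(1+δ_i) − 1`).
Gen 25 (`…B10Eq26SiteGauge`): `inverse_exp_mul_unitary`, `norm_exp_mul_sub_le` — used BY NAME; NEW: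
`norm_inverse_exp_mul_sub_star_le`.  The lineage's `BlockAveragingFederbushRadius.cexp_smul_one` (scalar exponential,
stated over that module's instances) is RE-PROVED here as `cexp_smul_one` for the L²-operator-normed `M_N(ℂ)` (two
lines), not imported.
-/

namespace Literature.MathematicalPhysics.QuantumFieldTheory.Balaban1983to89.B10Eq28CplxRegTube

open NormedSpace Set Metric Filter
open scoped Topology Matrix.Norms.L2Operator
open B7Prop1Explicit renaming Site → LSite
open B7Prop1Explicit (e l1)
open B7Prop1Local (InBox PlaqIn)
open B7Prop2SpecialUnitary (specialUnitaryUnits thetaN ZU)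
open B13Inv214Orbit (Ends gaugeAct gaugeAct_eq_star isUnit_of_mem_unitary inverse_eq_star_of_mem_unitary)
open B13Inv214OrbitSUN (OrbitConstOnIn SiteGaugeInvSU)
open B10Eq29TubeLine (cstarAlgebraMatrix Tube TubeCfg expLine abs_im_mul_norm_lt_of_mem_rect analyticOnStrip_expLine)
open B10Eq61Leaves (expChart)
open B10Eq61PerSite (Rect mem_rect LineInStrip AnalyticOnStrip DerivZeroAlongV diffAlongV
  logHalfBound_diffAlongV_of_derivZero inv_halfWidth_le)
open B10Eq26SiteGauge (norm_le_one_of_mem_unitary diffAlongV_eq_sub logHalfBound_congr inverse_exp_mul_unitary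
  norm_exp_mul_sub_le norm_exp_mul_le)
open B10Eq27AxialLog (plaq latEnds)
open B10Eq32AxialSuN (BoxBond boxEnds extCfg extCfg_coe extCfg_of_not extCfg_mem gaugeAct_boxEnds axialGenBox
  axialGenBox_mem_skewAdjoint norm_axialGenBox_le trace_axialGenBox_eq_zero exp_smul_mem_specialUnitaryGroup)
open B10Eq32RegularSuN (regSU mem_regSU one_mem_regSU gaugeAct_mem_regSU mem_regSU_of_norm_sub_one_le
  conjInvNear_of_orbitConstOnIn_regSU eq29_axialBox_reg plaq_gaugeAct norm_plaq_gaugeAct_sub_one plaqIn_bonds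
  sqBond inBox_sq_zero inBox_sq_e inBox_sq_ee logHalfBound_sub_box_of_orbitConstOnIn_regSU
  norm_exp_thetaN_sub_one_pos)
open B10Eq28RegularTube (RegTube mem_regTube exp_mul_mem_regTube mem_regTube_of_mem_regSU regTube_subset_tubeCfg
  regTube_mono regTube_mem_nhds regTube_mem_nhds_one expLine_mem_regTube lineInStrip_expLine_regTube
  gaugeAct_mem_regTube differentiableAt_comp_expChart_zero_of_mem_nhds
  derivZeroAlongV_of_suInvariantNear_of_differentiableAt logHalfBound_sub_box_of_regTube
  located26_strictly_weaker_on_regTube exists_windows norm_exp_ofReal_smul_sub_one_le norm_mul_le_of_norm_le_one_left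
  norm_mul_le_of_norm_le_one_right)

/-! ## §1. [folklore] THE PLAQUETTE VARIABLE WITH INVERSES of a complex configuration and its elementary estimates -/

section plaqinv

variable {𝔸 : Type*} [CStarAlgebra 𝔸] {d : ℕ}

/-- **The plaquette variable `𝐔(∂p)` of a (possibly non-unitary) configuration**: `φ(x,κ)·φ(x+e_κ,μ)·φ(x+e_μ,κ)⁻¹·
φ(x,μ)⁻¹` with `Ring.inverse` (`= 0` off the units) — print's convention `U(x, x′) = U⁻¹(x′, x)` for the reversed
bonds of `∂p`, which for complex (`Gᶜ`-valued) configurations is the INVERSE and not the adjoint (gen 26's `plaq`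
writes `⋆`, correct on the unitaries only: `plaqInv_eq_plaq`). [cite: Balaban1985Averaging, (7)–(9) p.18 («U(x, x′)
= U⁻¹(x′, x) = U*(x′, x)», «U(∂p) is defined by (9)»); Balaban1987RG1, (1.10) p.262 («(𝐔, 𝐉)ᵘ = (𝐔ᵘ, R(u)𝐉) =
(u₋𝐔u₊⁻¹, R(u₋)𝐉)»), p.261 («Im U = (1/2i)(U − U⁻¹)»), (1.14) p.262] -/
noncomputable def plaqInv (φ : LSite d × Fin d → 𝔸) (x : LSite d) (κ μ : Fin d) : 𝔸 :=
  φ (x, κ) * φ (x + e κ, μ) * Ring.inverse (φ (x + e μ, κ)) * Ring.inverse (φ (x, μ))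

/-- On unitary-valued configurations the plaquette variable with inverses is gen 26's `plaq`. [folklore] -/
theorem plaqInv_eq_plaq {φ : LSite d × Fin d → 𝔸} (hφ : ∀ b, φ b ∈ unitary 𝔸) (x : LSite d) (κ μ : Fin d) :
    plaqInv φ x κ μ = plaq φ x κ μ := by
  rw [plaqInv, plaq, inverse_eq_star_of_mem_unitary (hφ _), inverse_eq_star_of_mem_unitary (hφ _)]

/-- The flat configuration has trivial plaquette variables. [folklore] -/
@[simp] theorem plaqInv_one (x : LSite d) (κ μ : Fin d) : plaqInv (fun _ : LSite d × Fin d => (1 : 𝔸)) x κ μ = 1 := by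
  simp [plaqInv]

/-- The flat configuration has trivial (star) plaquette variables. [folklore] -/
@[simp] theorem plaq_one (x : LSite d) (κ μ : Fin d) : plaq (fun _ : LSite d × Fin d => (1 : 𝔸)) x κ μ = 1 := by
  simp [plaq]

/-- `(u·a·v⁻¹)⁻¹ = v·a⁻¹·u⁻¹` for units `u, v` and ANY `a` (`Ring.inverse`; both sides vanish when `a` is not a
unit). [folklore] -/
theorem inverse_isUnit_conj {u v : 𝔸} (hu : IsUnit u) (hv : IsUnit v) (a : 𝔸) :
    Ring.inverse (u * a * Ring.inverse v) = v * Ring.inverse a * Ring.inverse u := by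
  have hu1 : u * Ring.inverse u = 1 := Ring.mul_inverse_cancel _ hu
  have hu2 : Ring.inverse u * u = 1 := Ring.inverse_mul_cancel _ hu
  have hv1 : v * Ring.inverse v = 1 := Ring.mul_inverse_cancel _ hv
  have hv2 : Ring.inverse v * v = 1 := Ring.inverse_mul_cancel _ hv
  by_cases ha : IsUnit a
  · have h1 : a * Ring.inverse a = 1 := Ring.mul_inverse_cancel _ ha
    have h2 : Ring.inverse a * a = 1 := Ring.inverse_mul_cancel _ ha
    have h3 : u * a * Ring.inverse v * (v * Ring.inverse a * Ring.inverse u) = 1 := by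
      calc u * a * Ring.inverse v * (v * Ring.inverse a * Ring.inverse u)
          = u * (a * ((Ring.inverse v * v) * Ring.inverse a)) * Ring.inverse u := by noncomm_ring
        _ = 1 := by rw [hv2, one_mul, h1, mul_one, hu1]
    have h4 : v * Ring.inverse a * Ring.inverse u * (u * a * Ring.inverse v) = 1 := by
      calc v * Ring.inverse a * Ring.inverse u * (u * a * Ring.inverse v)
          = v * (Ring.inverse a * ((Ring.inverse u * u) * a)) * Ring.inverse v := by noncomm_ring
        _ = 1 := by rw [hu2, one_mul, h2, mul_one, hv1]
    exact Ring.inverse_unit (⟨_, _, h3, h4⟩ : 𝔸ˣ)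
  · have hb : ¬ IsUnit (u * a * Ring.inverse v) := fun h => ha (by
      have e1 : a = Ring.inverse u * (u * a * Ring.inverse v) * v := by
        calc a = (Ring.inverse u * u) * a * (Ring.inverse v * v) := by rw [hu2, hv2, one_mul, mul_one]
          _ = Ring.inverse u * (u * a * Ring.inverse v) * v := by noncomm_ring
      rw [e1]
      exact (hu.ringInverse.mul h).mul hv)
    rw [Ring.inverse_non_unit _ ha, Ring.inverse_non_unit _ hb, mul_zero, zero_mul]

/-- **Gauge covariance of the plaquette variable with inverses under the UNITS-valued (print: `Gᶜ`-valued) site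
transformations (1.10)**, for ANY configuration: `φᵘ(∂p) = u(x)·φ(∂p)·u(x)⁻¹` (b13's `gaugeAct`: `(φᵘ)_b = u(b₋)·φ_b·
u(b₊)⁻¹` with `Ring.inverse`). [cite: Balaban1987RG1, (1.10) p.262 («A Gᶜ-valued gauge transformation u acts on pairs
(𝐔, 𝐉) in the following way (𝐔, 𝐉)ᵘ = (𝐔ᵘ, R(u)𝐉) = (u₋𝐔u₊⁻¹, R(u₋)𝐉), (1.10) where for a bond b = ⟨b₋, b₊⟩ we
define u±(b) = u(b±)»); Balaban1985Averaging, (8) p.18 («Uᵘ(x, x′) = u(x)U(x, x′)u⁻¹(x′)»)] -/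
theorem plaqInv_gaugeAct_of_isUnit {u : LSite d → 𝔸} (hu : ∀ x, IsUnit (u x)) (φ : LSite d × Fin d → 𝔸)
    (x : LSite d) (κ μ : Fin d) :
    plaqInv (gaugeAct (latEnds d) u φ) x κ μ = u x * plaqInv φ x κ μ * Ring.inverse (u x) := by
  have hc : x + e μ + e κ = x + e κ + e μ := add_right_comm _ _ _
  simp only [plaqInv, gaugeAct, latEnds]
  rw [inverse_isUnit_conj (hu _) (hu _), inverse_isUnit_conj (hu _) (hu _), hc]
  calc u x * φ (x, κ) * Ring.inverse (u (x + e κ)) *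
        (u (x + e κ) * φ (x + e κ, μ) * Ring.inverse (u (x + e κ + e μ))) *
        (u (x + e κ + e μ) * Ring.inverse (φ (x + e μ, κ)) * Ring.inverse (u (x + e μ))) *
        (u (x + e μ) * Ring.inverse (φ (x, μ)) * Ring.inverse (u x))
      = u x * φ (x, κ) * (Ring.inverse (u (x + e κ)) * u (x + e κ)) * φ (x + e κ, μ) *
          (Ring.inverse (u (x + e κ + e μ)) * u (x + e κ + e μ)) * Ring.inverse (φ (x + e μ, κ)) *
          (Ring.inverse (u (x + e μ)) * u (x + e μ)) * Ring.inverse (φ (x, μ)) * Ring.inverse (u x) := by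
        noncomm_ring
    _ = u x * plaqInv φ x κ μ * Ring.inverse (u x) := by
        rw [Ring.inverse_mul_cancel _ (hu _), Ring.inverse_mul_cancel _ (hu _), Ring.inverse_mul_cancel _ (hu _),
          plaqInv]
        noncomm_ring

/-- … in particular under the UNITARY-valued (`G`-valued) ones: `φᵘ(∂p) = u(x)·φ(∂p)·u(x)⋆` (gen 28's `plaq_gaugeAct`
is the unitary-valued-`φ` case). [cite: Balaban1985Averaging, (8) p.18, (45) p.24; Balaban1987RG1, (1.10) p.262] -/
theorem plaqInv_gaugeAct {u : LSite d → 𝔸} (hu : ∀ x, u x ∈ unitary 𝔸) (φ : LSite d × Fin d → 𝔸) (x : LSite d)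
    (κ μ : Fin d) : plaqInv (gaugeAct (latEnds d) u φ) x κ μ = u x * plaqInv φ x κ μ * star (u x) := by
  rw [plaqInv_gaugeAct_of_isUnit (fun x => isUnit_of_mem_unitary (hu x)), inverse_eq_star_of_mem_unitary (hu x)]

/-- … hence `‖φᵘ(∂p) − 1‖ = ‖φ(∂p) − 1‖`: condition (iii) is a condition on ORBITS. [cite: Balaban1987RG1, p.262 («The
space Uᶜⱼ(X, α₀, α₁, γ₀) is a union of orbits [(𝐔, 𝐉)]»), p.263 («The spaces Uᶜⱼ(X, α₀, α₁) are, by the definition,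
gauge invariant also»)] -/
theorem norm_plaqInv_gaugeAct_sub_one {u : LSite d → 𝔸} (hu : ∀ x, u x ∈ unitary 𝔸)
    (φ : LSite d × Fin d → 𝔸) (x : LSite d) (κ μ : Fin d) :
    ‖plaqInv (gaugeAct (latEnds d) u φ) x κ μ - 1‖ = ‖plaqInv φ x κ μ - 1‖ := by
  rw [plaqInv_gaugeAct hu]
  have h : u x * plaqInv φ x κ μ * star (u x) - 1 = u x * (plaqInv φ x κ μ - 1) * star (u x) := by
    rw [mul_sub, sub_mul, mul_one, Unitary.mul_star_self_of_mem (hu x)]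
  rw [h, CStarRing.norm_mul_mem_unitary _ (Unitary.star_mem (hu x)), CStarRing.norm_mem_unitary_mul _ (hu x)]

/-- A plaquette variable inside the box reads only box bonds (gen 28's `plaq_extCfg_gaugeAct` for `plaqInv`).
[folklore] -/
theorem plaqInv_extCfg_gaugeAct {lo hi : LSite d} (u : LSite d → 𝔸) (V : BoxBond lo hi → 𝔸) {x : LSite d}
    {κ μ : Fin d} (h : PlaqIn lo hi (x, κ, μ)) :
    plaqInv (extCfg lo hi (gaugeAct (boxEnds lo hi) u V)) x κ μ =
      plaqInv (gaugeAct (latEnds d) u (extCfg lo hi V)) x κ μ := by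
  obtain ⟨h1, h2, h3, h4⟩ := plaqIn_bonds h
  have key : ∀ {b : LSite d × Fin d} (hb : InBox lo hi b.1 ∧ InBox lo hi (b.1 + e b.2)),
      extCfg lo hi (gaugeAct (boxEnds lo hi) u V) b = gaugeAct (latEnds d) u (extCfg lo hi V) b := by
    intro b hb
    have h := extCfg_coe (gaugeAct (boxEnds lo hi) u V) ⟨b, hb⟩
    rw [gaugeAct_boxEnds] at h
    exact h
  simp only [plaqInv]
  rw [key (b := (x, κ)) h1, key (b := (x + e κ, μ)) h2, key (b := (x + e μ, κ)) h3, key (b := (x, μ)) h4]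

/-- The extension-by-`1` of the flat configuration is flat. [folklore] -/
theorem extCfg_one (lo hi : LSite d) : extCfg lo hi (fun _ : BoxBond lo hi => (1 : 𝔸)) = fun _ => 1 := by
  funext b
  unfold extCfg
  split_ifs <;> rfl

/-- **Telescoping among NON-contractive factors**: `‖A₁A₂A₃A₄ − B₁B₂B₃B₄‖ ≤ (1+δ₁)(1+δ₂)(1+δ₃)(1+δ₄) − 1` when
`‖B₁‖, ‖B₂‖, ‖B₃‖ ≤ 1` and `‖Aᵢ − Bᵢ‖ ≤ δᵢ` (gen 30's `norm_mul4_sub_mul4_le` is the contractive case `‖Aᵢ‖ ≤ 1`,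
bound `Σδᵢ`; the inverses of tube points are NOT contractions). [folklore] -/
theorem norm_mul4_sub_mul4_le_prod {A₁ A₂ A₃ A₄ B₁ B₂ B₃ B₄ : 𝔸} {δ₁ δ₂ δ₃ δ₄ : ℝ} (hB₁ : ‖B₁‖ ≤ 1)
    (hB₂ : ‖B₂‖ ≤ 1) (hB₃ : ‖B₃‖ ≤ 1) (hB₄ : ‖B₄‖ ≤ 1) (h₁ : ‖A₁ - B₁‖ ≤ δ₁) (h₂ : ‖A₂ - B₂‖ ≤ δ₂)
    (h₃ : ‖A₃ - B₃‖ ≤ δ₃) (h₄ : ‖A₄ - B₄‖ ≤ δ₄) :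
    ‖A₁ * A₂ * A₃ * A₄ - B₁ * B₂ * B₃ * B₄‖ ≤ (1 + δ₁) * (1 + δ₂) * (1 + δ₃) * (1 + δ₄) - 1 := by
  have hδ₁ : 0 ≤ δ₁ := (norm_nonneg _).trans h₁
  have hδ₂ : 0 ≤ δ₂ := (norm_nonneg _).trans h₂
  have hδ₃ : 0 ≤ δ₃ := (norm_nonneg _).trans h₃
  have hδ₄ : 0 ≤ δ₄ := (norm_nonneg _).trans h₄
  have hA : ∀ {A B : 𝔸} {δ : ℝ}, ‖B‖ ≤ 1 → ‖A - B‖ ≤ δ → ‖A‖ ≤ 1 + δ := fun {A B δ} hB h =>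
    calc ‖A‖ = ‖B + (A - B)‖ := by rw [add_sub_cancel]
      _ ≤ ‖B‖ + ‖A - B‖ := norm_add_le _ _
      _ ≤ 1 + δ := add_le_add hB h
  have hA₂ : ‖A₂‖ ≤ 1 + δ₂ := hA hB₂ h₂
  have hA₃ : ‖A₃‖ ≤ 1 + δ₃ := hA hB₃ h₃
  have hA₄ : ‖A₄‖ ≤ 1 + δ₄ := hA hB₄ h₄
  have key : A₁ * A₂ * A₃ * A₄ - B₁ * B₂ * B₃ * B₄ = (A₁ - B₁) * A₂ * A₃ * A₄ + B₁ * (A₂ - B₂) * A₃ * A₄ +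
      B₁ * B₂ * (A₃ - B₃) * A₄ + B₁ * B₂ * B₃ * (A₄ - B₄) := by noncomm_ring
  have m4 : ∀ x y z w : 𝔸, ‖x * y * z * w‖ ≤ ‖x‖ * ‖y‖ * ‖z‖ * ‖w‖ := fun x y z w =>
    calc ‖x * y * z * w‖ ≤ ‖x * y * z‖ * ‖w‖ := norm_mul_le _ _
      _ ≤ ‖x * y‖ * ‖z‖ * ‖w‖ := mul_le_mul_of_nonneg_right (norm_mul_le _ _) (norm_nonneg _)
      _ ≤ ‖x‖ * ‖y‖ * ‖z‖ * ‖w‖ :=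
          mul_le_mul_of_nonneg_right (mul_le_mul_of_nonneg_right (norm_mul_le _ _) (norm_nonneg _)) (norm_nonneg _)
  have n1 : ‖(A₁ - B₁) * A₂ * A₃ * A₄‖ ≤ δ₁ * (1 + δ₂) * (1 + δ₃) * (1 + δ₄) :=
    (m4 _ _ _ _).trans (mul_le_mul (mul_le_mul (mul_le_mul h₁ hA₂ (norm_nonneg _) hδ₁) hA₃ (norm_nonneg _)
      (by positivity)) hA₄ (norm_nonneg _) (by positivity))
  have n2 : ‖B₁ * (A₂ - B₂) * A₃ * A₄‖ ≤ 1 * δ₂ * (1 + δ₃) * (1 + δ₄) :=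
    (m4 _ _ _ _).trans (mul_le_mul (mul_le_mul (mul_le_mul hB₁ h₂ (norm_nonneg _) zero_le_one) hA₃ (norm_nonneg _)
      (by positivity)) hA₄ (norm_nonneg _) (by positivity))
  have n3 : ‖B₁ * B₂ * (A₃ - B₃) * A₄‖ ≤ 1 * 1 * δ₃ * (1 + δ₄) :=
    (m4 _ _ _ _).trans (mul_le_mul (mul_le_mul (mul_le_mul hB₁ hB₂ (norm_nonneg _) zero_le_one) h₃ (norm_nonneg _)
      (by positivity)) hA₄ (norm_nonneg _) (by positivity))
  have n4 : ‖B₁ * B₂ * B₃ * (A₄ - B₄)‖ ≤ 1 * 1 * 1 * δ₄ :=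
    (m4 _ _ _ _).trans (mul_le_mul (mul_le_mul (mul_le_mul hB₁ hB₂ (norm_nonneg _) zero_le_one) hB₃ (norm_nonneg _)
      (by positivity)) h₄ (norm_nonneg _) (by positivity))
  rw [key]
  calc ‖(A₁ - B₁) * A₂ * A₃ * A₄ + B₁ * (A₂ - B₂) * A₃ * A₄ + B₁ * B₂ * (A₃ - B₃) * A₄ + B₁ * B₂ * B₃ * (A₄ - B₄)‖
      ≤ ‖(A₁ - B₁) * A₂ * A₃ * A₄‖ + ‖B₁ * (A₂ - B₂) * A₃ * A₄‖ + ‖B₁ * B₂ * (A₃ - B₃) * A₄‖ +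
          ‖B₁ * B₂ * B₃ * (A₄ - B₄)‖ :=
        (norm_add_le _ _).trans (add_le_add ((norm_add_le _ _).trans (add_le_add (norm_add_le _ _) le_rfl)) le_rfl)
    _ ≤ δ₁ * (1 + δ₂) * (1 + δ₃) * (1 + δ₄) + 1 * δ₂ * (1 + δ₃) * (1 + δ₄) + 1 * 1 * δ₃ * (1 + δ₄) + 1 * 1 * 1 * δ₄ :=
        add_le_add (add_le_add (add_le_add n1 n2) n3) n4
    _ = (1 + δ₁) * (1 + δ₂) * (1 + δ₃) * (1 + δ₄) - 1 := by ring

/-- The inverse of a tube point `exp(B)·U` lies within `e^{‖B‖} − 1` of `U⋆ = U⁻¹` (gen 25's `inverse_exp_mul_unitary`: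
`(exp(B)U)⁻¹ = U⋆ exp(−B)`). [folklore] -/
theorem norm_inverse_exp_mul_sub_star_le (B : 𝔸) {U : 𝔸} (hU : U ∈ unitary 𝔸) :
    ‖Ring.inverse (exp B * U) - star U‖ ≤ Real.exp ‖B‖ - 1 := by
  letI : NormedAlgebra ℚ 𝔸 := NormedAlgebra.restrictScalars ℚ ℂ 𝔸
  rw [inverse_exp_mul_unitary B hU, show star U * exp (-B) - star U = star U * (exp (-B) - 1) by
    rw [mul_sub, mul_one]]
  calc ‖star U * (exp (-B) - 1)‖ ≤ ‖exp (-B) - 1‖ :=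
        norm_mul_le_of_norm_le_one_left (by rw [norm_star]; exact norm_le_one_of_mem_unitary hU) _
    _ ≤ Real.exp ‖-B‖ - 1 := _root_.Literature.Analysis.Calculus.norm_exp_sub_one_le (-B)
    _ = Real.exp ‖B‖ - 1 := by rw [norm_neg]

/-- **The plaquette variable with inverses near a unitary-valued configuration**: if `‖φ_b − ψ_b‖ ≤ δ` and `‖φ_b⁻¹ −
ψ_b⋆‖ ≤ δ` on every bond, `ψ` unitary-valued, then `‖φ(∂p) − ψ(∂p)‖ ≤ (1 + δ)⁴ − 1`. [folklore] -/
theorem norm_plaqInv_sub_plaq_le {φ ψ : LSite d × Fin d → 𝔸} {δ : ℝ} (hψ : ∀ b, ψ b ∈ unitary 𝔸)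
    (h₁ : ∀ b, ‖φ b - ψ b‖ ≤ δ) (h₂ : ∀ b, ‖Ring.inverse (φ b) - star (ψ b)‖ ≤ δ) (x : LSite d) (κ μ : Fin d) :
    ‖plaqInv φ x κ μ - plaq ψ x κ μ‖ ≤ (1 + δ) ^ 4 - 1 := by
  rw [plaqInv, plaq]
  have h1 : ∀ b, ‖ψ b‖ ≤ 1 := fun b => norm_le_one_of_mem_unitary (hψ b)
  have h1' : ∀ b, ‖star (ψ b)‖ ≤ 1 := fun b => by rw [norm_star]; exact h1 b
  calc ‖φ (x, κ) * φ (x + e κ, μ) * Ring.inverse (φ (x + e μ, κ)) * Ring.inverse (φ (x, μ)) -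
        ψ (x, κ) * ψ (x + e κ, μ) * star (ψ (x + e μ, κ)) * star (ψ (x, μ))‖
      ≤ (1 + δ) * (1 + δ) * (1 + δ) * (1 + δ) - 1 :=
        norm_mul4_sub_mul4_le_prod (h1 _) (h1 _) (h1' _) (h1' _) (h₁ _) (h₁ _) (h₂ _) (h₂ _)
    _ = (1 + δ) ^ 4 - 1 := by ring

/-- **The plaquette variables of a tube point over a unitary-valued base**: for `V_b = exp(B_b)·U_b` on the box with
`‖B_b‖ ≤ β`, `U` unitary-valued, every plaquette variable (with inverses) of `V` is within `e^{4β} − 1` of the (star)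
plaquette variable of `U`. [folklore] -/
theorem norm_plaqInv_extCfg_sub_le {lo hi : LSite d} {β : ℝ} (hβ : 0 ≤ β) {B U : BoxBond lo hi → 𝔸}
    (hB : ∀ b, ‖B b‖ ≤ β) (hU : ∀ b, U b ∈ unitary 𝔸) (x : LSite d) (κ μ : Fin d) :
    ‖plaqInv (extCfg lo hi fun b => exp (B b) * U b) x κ μ - plaq (extCfg lo hi U) x κ μ‖ ≤
      Real.exp (4 * β) - 1 := by
  have hδ : 0 ≤ Real.exp β - 1 := by linarith [Real.add_one_le_exp β]
  have hψ : ∀ b, extCfg lo hi U b ∈ unitary 𝔸 := extCfg_mem hU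
  have hb : ∀ b : LSite d × Fin d, ‖extCfg lo hi (fun b => exp (B b) * U b) b - extCfg lo hi U b‖ ≤ Real.exp β - 1 ∧
      ‖Ring.inverse (extCfg lo hi (fun b => exp (B b) * U b) b) - star (extCfg lo hi U b)‖ ≤ Real.exp β - 1 := by
    intro b
    by_cases h : InBox lo hi b.1 ∧ InBox lo hi (b.1 + e b.2)
    · have e1 : extCfg lo hi (fun b => exp (B b) * U b) b = exp (B ⟨b, h⟩) * U ⟨b, h⟩ := extCfg_coe _ ⟨b, h⟩
      have e2 : extCfg lo hi U b = U ⟨b, h⟩ := extCfg_coe _ ⟨b, h⟩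
      have hm : Real.exp ‖B ⟨b, h⟩‖ - 1 ≤ Real.exp β - 1 := by linarith [Real.exp_le_exp.mpr (hB ⟨b, h⟩)]
      rw [e1, e2]
      exact ⟨(norm_exp_mul_sub_le _ (hU _)).trans hm, (norm_inverse_exp_mul_sub_star_le _ (hU _)).trans hm⟩
    · rw [extCfg_of_not _ h, extCfg_of_not _ h, Ring.inverse_one, star_one, sub_self, norm_zero]
      exact ⟨hδ, hδ⟩
  have h4 : (1 + (Real.exp β - 1)) ^ 4 = Real.exp (4 * β) := by
    rw [add_sub_cancel, ← Real.exp_nat_mul]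
    norm_num
  calc ‖plaqInv (extCfg lo hi fun b => exp (B b) * U b) x κ μ - plaq (extCfg lo hi U) x κ μ‖
      ≤ (1 + (Real.exp β - 1)) ^ 4 - 1 := norm_plaqInv_sub_plaq_le hψ (fun b => (hb b).1) (fun b => (hb b).2) x κ μ
    _ = Real.exp (4 * β) - 1 := by rw [h4]

end plaqinv

/-! ## §2. [I] (1.14): THE COMPLEX-REGULAR TUBE — gen 30's regular tube CUT by condition (iii) on the plaquette
## variables of the complex configuration itself -/

section regcplx

variable {𝔸 : Type*} [CStarAlgebra 𝔸] {d : ℕ}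

/-- **CONDITION (iii)** on a configuration of the box (any values): every plaquette `p ⊂ Λ` (b07's `PlaqIn`, `κ ≠ μ`)
has its plaquette variable WITH INVERSES within `α″` of `1` (print: strict `<`, constant `α₀ξ²` — the SAME constant as
in (i) (1.11); here `≤ α″`, as gen 28's `regSU` reads (1.11)/(13) with `≤ α′`). [cite: Balaban1987RG1, (1.14) p.262
(«(iii) The configurations 𝐔, 𝐉 satisfy the bounds |∂𝐔 − 1| < α₀ξ², |𝐉| < γ₀ on X»)] -/
def RegCplx (lo hi : LSite d) (α'' : ℝ) : Set (BoxBond lo hi → 𝔸) :=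
  {V | ∀ (x : LSite d) (κ μ : Fin d), κ ≠ μ → PlaqIn lo hi (x, κ, μ) → ‖plaqInv (extCfg lo hi V) x κ μ - 1‖ ≤ α''}

/-- Unfolding. [folklore] -/
theorem mem_regCplx {lo hi : LSite d} {α'' : ℝ} {V : BoxBond lo hi → 𝔸} :
    V ∈ RegCplx lo hi α'' ↔
      ∀ (x : LSite d) (κ μ : Fin d), κ ≠ μ → PlaqIn lo hi (x, κ, μ) → ‖plaqInv (extCfg lo hi V) x κ μ - 1‖ ≤ α'' :=
  Iff.rfl

/-- Monotonicity in the window. [cite: Balaban1987RG1, p.263 («We assume that the constants α′₀, α′₁ are smaller than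
α₀, α₁ correspondingly, then obviously these three conditions are satisfied in the original formulation»)] -/
theorem regCplx_mono {lo hi : LSite d} {α'' α''₁ : ℝ} (h : α'' ≤ α''₁) :
    RegCplx (𝔸 := 𝔸) lo hi α'' ⊆ RegCplx lo hi α''₁ :=
  fun _ hV x κ μ hne hp => (hV x κ μ hne hp).trans h

/-- The flat configuration satisfies (iii) (`α″ ≥ 0`). [folklore] -/
theorem one_mem_regCplx {lo hi : LSite d} {α'' : ℝ} (h : 0 ≤ α'') :
    (fun _ : BoxBond lo hi => (1 : 𝔸)) ∈ RegCplx lo hi α'' := fun x κ μ _ _ => by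
  rw [extCfg_one, plaqInv_one, sub_self, norm_zero]
  exact h

/-- **Condition (iii) is invariant under the unitary-valued site gauge transformations** (plaquette variables are
gauge covariant, §1). [cite: Balaban1987RG1, p.263 («The spaces Uᶜⱼ(X, α₀, α₁) are, by the definition, gauge invariant
also»)] -/
theorem gaugeAct_mem_regCplx {lo hi : LSite d} {α'' : ℝ} {u : LSite d → 𝔸} (hu : ∀ x, u x ∈ unitary 𝔸)
    {V : BoxBond lo hi → 𝔸} (hV : V ∈ RegCplx lo hi α'') : gaugeAct (boxEnds lo hi) u V ∈ RegCplx lo hi α'' :=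
  fun x κ μ hne hp => by
    rw [plaqInv_extCfg_gaugeAct u V hp, norm_plaqInv_gaugeAct_sub_one hu]
    exact hV x κ μ hne hp

/-- **Condition (iii) with room to spare is preserved near a units-valued configuration**: if `V₀` is units-valued
and satisfies (iii) STRICTLY, then (iii) holds on a neighbourhood of `V₀` (finitely many plaquettes in the box; the
plaquette variable with inverses is continuous at units-valued configurations, `Ring.inverse` being continuous on the
units).  (`RegCplx` itself is NOT open: `Ring.inverse` vanishes off the units.) [folklore] -/
theorem regCplx_mem_nhds {lo hi : LSite d} {α'' : ℝ} {V₀ : BoxBond lo hi → 𝔸} (hV₀ : ∀ b, IsUnit (V₀ b))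
    (h : ∀ (x : LSite d) (κ μ : Fin d), κ ≠ μ → PlaqIn lo hi (x, κ, μ) →
      ‖plaqInv (extCfg lo hi V₀) x κ μ - 1‖ < α'') :
    RegCplx lo hi α'' ∈ 𝓝 V₀ := by
  have hu : ∀ b, IsUnit (extCfg lo hi V₀ b) := fun b => by
    unfold extCfg
    split_ifs
    exacts [hV₀ _, isUnit_one]
  have hc : ∀ b, Continuous fun V : BoxBond lo hi → 𝔸 => extCfg lo hi V b := fun b => by
    unfold extCfg
    split_ifs
    exacts [continuous_apply _, continuous_const]
  have hci : ∀ b, ContinuousAt (fun V : BoxBond lo hi → 𝔸 => Ring.inverse (extCfg lo hi V b)) V₀ := fun b => by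
    obtain ⟨w, hw⟩ := hu b
    have h1 : ContinuousAt Ring.inverse (extCfg lo hi V₀ b) := by
      rw [← hw]
      exact NormedRing.inverse_continuousAt w
    have h2 : ContinuousAt (fun V : BoxBond lo hi → 𝔸 => extCfg lo hi V b) V₀ := (hc b).continuousAt
    exact ContinuousAt.comp (g := Ring.inverse) h1 h2
  have hf : ∀ (x : LSite d) (κ μ : Fin d), ContinuousAt (fun V => plaqInv (extCfg lo hi V) x κ μ) V₀ :=
    fun x κ μ => (((hc _).continuousAt.mul (hc _).continuousAt).mul (hci _)).mul (hci _)
  have hfin : Set.Finite {P : LSite d × Fin d × Fin d | PlaqIn lo hi P} :=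
    ((Set.finite_Icc lo hi).prod (Set.finite_univ : (Set.univ : Set (Fin d × Fin d)).Finite)).subset
      (by
        rintro ⟨x, κ, μ⟩ ⟨hx, -⟩
        exact ⟨⟨fun i => (hx i).1, fun i => (hx i).2⟩, Set.mem_univ _⟩)
  have hmem : ∀ P ∈ {P : LSite d × Fin d × Fin d | PlaqIn lo hi P},
      {V : BoxBond lo hi → 𝔸 | P.2.1 ≠ P.2.2 → ‖plaqInv (extCfg lo hi V) P.1 P.2.1 P.2.2 - 1‖ ≤ α''} ∈ 𝓝 V₀ := by
    rintro ⟨x, κ, μ⟩ hP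
    by_cases hne : κ ≠ μ
    · have hball : Metric.closedBall (1 : 𝔸) α'' ∈ 𝓝 (plaqInv (extCfg lo hi V₀) x κ μ) :=
        mem_of_superset (isOpen_ball.mem_nhds (by rw [mem_ball, dist_eq_norm]; exact h x κ μ hne hP))
          ball_subset_closedBall
      exact mem_of_superset ((hf x κ μ).preimage_mem_nhds hball) fun V hV _ => by
        simpa only [Set.mem_preimage, mem_closedBall, dist_eq_norm] using hV
    · exact univ_mem' fun V h' => absurd h' hne
  refine mem_of_superset ((Filter.biInter_mem hfin).mpr hmem) fun V hV x κ μ hne hP => ?_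
  exact (Set.mem_iInter₂.mp hV) (x, κ, μ) hP hne

/-- In particular (iii) holds near the flat configuration (`α″ > 0`). [folklore] -/
theorem regCplx_mem_nhds_one {lo hi : LSite d} {α'' : ℝ} (h : 0 < α'') :
    RegCplx lo hi α'' ∈ 𝓝 (fun _ : BoxBond lo hi => (1 : 𝔸)) :=
  regCplx_mem_nhds (fun _ => isUnit_one) fun x κ μ _ _ => by
    rw [extCfg_one, plaqInv_one, sub_self, norm_zero]
    exact h

end regcplx

section cplxregtube

variable (N : ℕ) {d : ℕ}

attribute [local instance] B10Eq29TubeLine.cstarAlgebraMatrix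

/-- `M_N(ℂ)`. -/
local notation "M[" N "]" => Matrix (Fin N) (Fin N) ℂ

/-- **THE COMPLEX-REGULAR TUBE — [I]'s analyticity space `Uᶜⱼ(X, α₀, α₁)` located in ALL THREE of its conditions on
`𝐔`**: the configurations `V_b = exp(B_b)·U_b` of the box with all `‖B_b‖ < a` ((ii), half-width `a`), `U` a REGULAR
`SU(N)`-valued configuration of window `α′` ((i), gen 28's `regSU`), AND every plaquette variable with inverses of `V`
ITSELF within `α″` of `1` ((iii), `RegCplx`).  Gen 30's `RegTube N lo hi a α′` is conditions (i)–(ii) (its HONEST SCOPE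
(ii): «condition (iii) … is NOT modelled»); print has `α″ = α′ = α₀ξ²`. [cite: Balaban1987RG1, (1.11)–(1.14) p.262,
p.262 («The space Uᶜⱼ(X, α₀, α₁, γ₀) is a union of orbits [(𝐔, 𝐉)] determined by configurations 𝐔, 𝐉 satisfying the
four conditions written below»), p.263 («We assume that the function 𝐄⁽ʲ⁾(X, g_{j−1}, 𝐔, 𝐉) is defined and analytic on
the space Uᶜⱼ(X, α₀, α₁), with some positive, absolute constants α₀, α₁»)] -/
def CplxRegTube (lo hi : LSite d) (a α' α'' : ℝ) : Set (BoxBond lo hi → M[N]) :=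
  RegTube N lo hi a α' ∩ RegCplx lo hi α''

variable {N}

/-- Unfolding. [folklore] -/
theorem mem_cplxRegTube {lo hi : LSite d} {a α' α'' : ℝ} {V : BoxBond lo hi → M[N]} :
    V ∈ CplxRegTube N lo hi a α' α'' ↔ V ∈ RegTube N lo hi a α' ∧
      ∀ (x : LSite d) (κ μ : Fin d), κ ≠ μ → PlaqIn lo hi (x, κ, μ) →
        ‖plaqInv (extCfg lo hi V) x κ μ - 1‖ ≤ α'' :=
  Iff.rfl

/-- The complex-regular tube lies in the regular tube … [folklore] -/
theorem cplxRegTube_subset_regTube {lo hi : LSite d} {a α' α'' : ℝ} :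
    CplxRegTube N lo hi a α' α'' ⊆ RegTube N lo hi a α' :=
  inter_subset_left

/-- … hence in gen 23's bondwise tube of the same half-width. [folklore] -/
theorem cplxRegTube_subset_tubeCfg {lo hi : LSite d} {a α' α'' : ℝ} :
    CplxRegTube N lo hi a α' α'' ⊆ TubeCfg (BoxBond lo hi) M[N] a :=
  cplxRegTube_subset_regTube.trans regTube_subset_tubeCfg

/-- Monotonicity in the three windows. [cite: Balaban1987RG1, p.263 («then obviously these three conditions are
satisfied in the original formulation»)] -/
theorem cplxRegTube_mono {lo hi : LSite d} {a a₁ α' α'₁ α'' α''₁ : ℝ} (ha : a ≤ a₁) (hα' : α' ≤ α'₁)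
    (hα'' : α'' ≤ α''₁) : CplxRegTube N lo hi a α' α'' ⊆ CplxRegTube N lo hi a₁ α'₁ α''₁ :=
  inter_subset_inter (regTube_mono ha hα') (regCplx_mono hα'')

/-- **(i)–(ii) CONTROL (iii) UP TO THE TUBE WIDTH**: a point of the regular tube has every plaquette variable (with
inverses) within `α′ + (e^{4a} − 1)` of `1` — its base is regular (window `α′`) and each of the four factors moves by at
most `e^a − 1` (§1).  Print's remark of this shape (for its gauge-potential conditions): (ii)-type bounds on `U′U` give
the (i)-type regularity «with α₀ replaced by O(1)(α₀ + α₁)». [cite: Balaban1985BackgroundPropagators, p.396–397 («We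
will prove in another paper that if U′U satisfies the conditions (3.37), (3.38), then it satisfies also (3.35), (3.36)
with α₀ replaced by O(1)(α₀ + α₁), but we will not use this fact here»)] -/
theorem norm_plaqInv_sub_one_le_of_mem_regTube {lo hi : LSite d} {a α' : ℝ} {V : BoxBond lo hi → M[N]}
    (hV : V ∈ RegTube N lo hi a α') {x : LSite d} {κ μ : Fin d} (hne : κ ≠ μ) (hp : PlaqIn lo hi (x, κ, μ)) :
    ‖plaqInv (extCfg lo hi V) x κ μ - 1‖ ≤ α' + (Real.exp (4 * a) - 1) := by
  obtain ⟨B, U, hB, hU, rfl⟩ := hV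
  have ha : 0 ≤ a := (norm_nonneg _).trans (hB ⟨(x, κ), (plaqIn_bonds hp).1⟩).le
  have hUu : ∀ b, U b ∈ unitary M[N] := fun b => (Matrix.mem_specialUnitaryGroup_iff.mp (hU.1 b)).1
  have h1 := norm_plaqInv_extCfg_sub_le ha (fun b => (hB b).le) hUu x κ μ
  have h2 := hU.2 x κ μ hne hp
  calc ‖plaqInv (extCfg lo hi fun b => exp (B b) * U b) x κ μ - 1‖
      = ‖(plaqInv (extCfg lo hi fun b => exp (B b) * U b) x κ μ - plaq (extCfg lo hi U) x κ μ) +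
          (plaq (extCfg lo hi U) x κ μ - 1)‖ := by rw [sub_add_sub_cancel]
    _ ≤ (Real.exp (4 * a) - 1) + α' := (norm_add_le _ _).trans (add_le_add h1 h2)
    _ = α' + (Real.exp (4 * a) - 1) := add_comm _ _

/-- **THE UPPER END OF THE BRACKET**: for `α″ ≥ α′ + (e^{4a} − 1)` condition (iii) is implied by (i)–(ii) — the
complex-regular tube IS gen 30's regular tube. [folklore] -/
theorem regTube_subset_regCplx {lo hi : LSite d} {a α' α'' : ℝ} (h : α' + (Real.exp (4 * a) - 1) ≤ α'') :
    RegTube N lo hi a α' ⊆ RegCplx lo hi α'' :=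
  fun _ hV _ _ _ hne hp => (norm_plaqInv_sub_one_le_of_mem_regTube hV hne hp).trans h

/-- … as an equality of sets. [folklore] -/
theorem cplxRegTube_eq_regTube {lo hi : LSite d} {a α' α'' : ℝ} (h : α' + (Real.exp (4 * a) - 1) ≤ α'') :
    CplxRegTube N lo hi a α' α'' = RegTube N lo hi a α' :=
  inter_eq_left.mpr (regTube_subset_regCplx h)

/-- **The regular configurations of window `α′ ≤ α″` lie in the complex-regular tube** (`a > 0`; `B = 0`, and on the
unitaries the two plaquette variables agree) — in particular at print's `α″ = α′`. [cite: Balaban1987RG1, p.263 («In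
particular the minimal configurations Uⱼ satisfying the bound |∂Uⱼ − 1| < ε₀ξ² with ε₀ sufficiently small, satisfy
the above conditions»)] -/
theorem mem_cplxRegTube_of_mem_regSU {lo hi : LSite d} {a α' α'' : ℝ} (ha : 0 < a) (hα : α' ≤ α'')
    {U : BoxBond lo hi → M[N]} (hU : U ∈ regSU N lo hi α') : U ∈ CplxRegTube N lo hi a α' α'' := by
  have hUu : ∀ b, U b ∈ unitary M[N] := fun b => (Matrix.mem_specialUnitaryGroup_iff.mp (hU.1 b)).1
  exact ⟨mem_regTube_of_mem_regSU ha hU, fun x κ μ hne hp => by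
    rw [plaqInv_eq_plaq (extCfg_mem hUu)]
    exact (hU.2 x κ μ hne hp).trans hα⟩

/-- The flat configuration lies in the complex-regular tube (`a > 0`, `α′, α″ ≥ 0`). [folklore] -/
theorem one_mem_cplxRegTube {lo hi : LSite d} {a α' α'' : ℝ} (ha : 0 < a) (hα' : 0 ≤ α') (hα'' : 0 ≤ α'') :
    (fun _ => (1 : M[N])) ∈ CplxRegTube N lo hi a α' α'' :=
  ⟨mem_regTube_of_mem_regSU ha (one_mem_regSU hα'), one_mem_regCplx hα''⟩

/-- **The complex-regular tube is a neighbourhood of every regular configuration with window to spare** (`a > 0`,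
`U ∈ regSU N lo hi α′`, `α′ < α″`): gen 30's `regTube_mem_nhds` and §2's `regCplx_mem_nhds`. [folklore] -/
theorem cplxRegTube_mem_nhds {lo hi : LSite d} {a α' α'' : ℝ} (ha : 0 < a) (hα : α' < α'')
    {U : BoxBond lo hi → M[N]} (hU : U ∈ regSU N lo hi α') : CplxRegTube N lo hi a α' α'' ∈ 𝓝 U := by
  have hUu : ∀ b, U b ∈ unitary M[N] := fun b => (Matrix.mem_specialUnitaryGroup_iff.mp (hU.1 b)).1
  exact inter_mem (regTube_mem_nhds ha hU) (regCplx_mem_nhds (fun b => isUnit_of_mem_unitary (hUu b))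
    fun x κ μ hne hp => by
      rw [plaqInv_eq_plaq (extCfg_mem hUu)]
      exact (hU.2 x κ μ hne hp).trans_lt hα)

/-- **The complex-regular tube is a neighbourhood of the flat configuration** (`a > 0`, `α′ ≥ 0`, `α″ > 0`) — what
b13's binder (a) at the base point `1` needs (§4). [folklore] -/
theorem cplxRegTube_mem_nhds_one {lo hi : LSite d} {a α' α'' : ℝ} (ha : 0 < a) (hα' : 0 ≤ α') (hα'' : 0 < α'') :
    CplxRegTube N lo hi a α' α'' ∈ 𝓝 (fun _ => (1 : M[N])) :=
  inter_mem (regTube_mem_nhds_one ha hα') (regCplx_mem_nhds_one hα'')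

/-- **The complex-regular tube is invariant under the `SU(N)`-valued site gauge transformations** (gen 30's
`gaugeAct_mem_regTube` and §2's `gaugeAct_mem_regCplx`). [cite: Balaban1987RG1, p.262 («The space Uᶜⱼ(X, α₀, α₁, γ₀)
is a union of orbits [(𝐔, 𝐉)]»), p.263 («The spaces Uᶜⱼ(X, α₀, α₁) are, by the definition, gauge invariant also»)] -/
theorem gaugeAct_mem_cplxRegTube {lo hi : LSite d} {a α' α'' : ℝ} {u : LSite d → M[N]}
    (hu : ∀ x, u x ∈ Matrix.specialUnitaryGroup (Fin N) ℂ) {V : BoxBond lo hi → M[N]}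
    (hV : V ∈ CplxRegTube N lo hi a α' α'') : gaugeAct (boxEnds lo hi) u V ∈ CplxRegTube N lo hi a α' α'' :=
  ⟨gaugeAct_mem_regTube hu hV.1,
    gaugeAct_mem_regCplx (fun x => (Matrix.mem_specialUnitaryGroup_iff.mp (hu x)).1) hV.2⟩

/-! ## §3. B10 (29): THE STRIP CURVES OF A SMALL GENERATOR STAY IN THE COMPLEX-REGULAR TUBE -/

/-- **THE LINE (29) SATISFIES (iii)**: for a bondwise skew-Hermitian traceless generator `H` with `‖H_b‖ ≤ κ`
(`κ > 0`, sets the strip `Rect (a/κ)`) and `‖H_b‖ ≤ ρ`, SMALL in the sense `4(ρ + a) ≤ α′` (gen 30) AND `e^{4(ρ + 2a)}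
− 1 ≤ α″` (NEW — on the strip `‖ζH_b‖ ≤ |Re ζ|·‖H_b‖ + |Im ζ|·‖H_b‖ ≤ (ρ + a) + a`, and the four factors of a plaquette
variable of `exp(ζH)·1` are each within `e^{ρ+2a} − 1` of `1`, §1), the curve `ζ ↦ exp(ζH)·1` lies in the
complex-regular tube for `ζ ∈ Rect (a/κ)`.  Print: (28) makes `sup|log …| + sup|A′|` SMALL «for g₀ sufficiently
small», whence (29) preserves the regularity AND the bounds of the analyticity space. [cite: Balaban1985UV3, (28)–(29)
p.263 («and for g₀ sufficiently small the number on the right-hand side above is small»); Balaban1987RG1, (1.11)–(1.14)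
p.262] -/
theorem expLine_mem_cplxRegTube {D : LocDomainSys} {lo hi : LSite d} {a α' α'' κ ρ : ℝ}
    {gen : D.Dom → (BoxBond lo hi → M[N]) → BoxBond lo hi → M[N]} {X : D.Dom} {φ : BoxBond lo hi → M[N]}
    (hHs : ∀ b, star (gen X φ b) = -gen X φ b) (hHt : ∀ b, Matrix.trace (gen X φ b) = 0) (hκ : 0 < κ)
    (hHκ : ∀ b, ‖gen X φ b‖ ≤ κ) (hρ : 0 ≤ ρ) (hHρ : ∀ b, ‖gen X φ b‖ ≤ ρ) (ha : 0 ≤ a)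
    (h4 : 4 * (ρ + a) ≤ α') (h3 : Real.exp (4 * (ρ + 2 * a)) - 1 ≤ α'') {ζ : ℂ} (hζ : ζ ∈ Rect (a / κ)) :
    expLine gen (fun _ _ _ => 1) X φ ζ ∈ CplxRegTube N lo hi a α' α'' := by
  refine ⟨expLine_mem_regTube hHs hHt hκ hHκ hρ hHρ ha h4 hζ, fun x κ₁ μ₁ _ _ => ?_⟩
  have hre : |ζ.re| ≤ 1 + a / κ := by
    rw [mem_rect] at hζ
    obtain ⟨-, -, h1, h2⟩ := hζ
    have haκ : 0 ≤ a / κ := div_nonneg ha hκ.le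
    exact abs_le.mpr ⟨by linarith, by linarith⟩
  have hB : ∀ b, ‖ζ • gen X φ b‖ ≤ ρ + 2 * a := fun b => by
    have him : |ζ.im| * ‖gen X φ b‖ < a := abs_im_mul_norm_lt_of_mem_rect hκ (hHκ b) hζ
    have hq : ‖gen X φ b‖ / κ ≤ 1 := (div_le_one hκ).mpr (hHκ b)
    have hre' : |ζ.re| * ‖gen X φ b‖ ≤ ρ + a :=
      calc |ζ.re| * ‖gen X φ b‖ ≤ (1 + a / κ) * ‖gen X φ b‖ := mul_le_mul_of_nonneg_right hre (norm_nonneg _)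
        _ = ‖gen X φ b‖ + a * (‖gen X φ b‖ / κ) := by
            field_simp
        _ ≤ ρ + a * 1 := add_le_add (hHρ b) (mul_le_mul_of_nonneg_left hq ha)
        _ = ρ + a := by ring
    calc ‖ζ • gen X φ b‖ = ‖ζ‖ * ‖gen X φ b‖ := norm_smul _ _
      _ ≤ (|ζ.re| + |ζ.im|) * ‖gen X φ b‖ :=
          mul_le_mul_of_nonneg_right (Complex.norm_le_abs_re_add_abs_im ζ) (norm_nonneg _)
      _ = |ζ.re| * ‖gen X φ b‖ + |ζ.im| * ‖gen X φ b‖ := by ring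
      _ ≤ (ρ + a) + a := add_le_add hre' him.le
      _ = ρ + 2 * a := by ring
  have hρa : 0 ≤ ρ + 2 * a := by positivity
  have key := norm_plaqInv_extCfg_sub_le hρa hB (fun _ => (one_mem _ : (1 : M[N]) ∈ unitary M[N])) x κ₁ μ₁
  rw [extCfg_one, plaq_one] at key
  exact key.trans h3

/-- **(L1′) DISCHARGED ON THE COMPLEX-REGULAR TUBE**: gen 30's `lineInStrip_expLine_regTube` with the analyticity
space containing only the COMPLEX-REGULAR tube `CplxRegTube N lo hi a α′ α″`, at the price of the second smallness
binder `e^{4(ρ X + 2a)} − 1 ≤ α″`. [cite: Balaban1985UV3, (28)–(29) p.263; Balaban1987RG1, (1.11)–(1.14) p.262] -/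
theorem lineInStrip_expLine_cplxRegTube {D : LocDomainSys} {lo hi : LSite d} {a α' α'' : ℝ}
    {sp' sp : D.Dom → Set (BoxBond lo hi → M[N])} {gen : D.Dom → (BoxBond lo hi → M[N]) → BoxBond lo hi → M[N]}
    {κ ρ : D.Dom → ℝ} (hgen : ∀ X φ, φ ∈ sp' X → ∀ b, star (gen X φ b) = -gen X φ b)
    (htr : ∀ X φ, φ ∈ sp' X → ∀ b, Matrix.trace (gen X φ b) = 0) (hκ : ∀ X, 0 < κ X)
    (hbound : ∀ X φ, φ ∈ sp' X → ∀ b, ‖gen X φ b‖ ≤ κ X) (hρ : ∀ X, 0 ≤ ρ X)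
    (hsmall : ∀ X φ, φ ∈ sp' X → ∀ b, ‖gen X φ b‖ ≤ ρ X) (ha : 0 ≤ a) (h4 : ∀ X, 4 * (ρ X + a) ≤ α')
    (h3 : ∀ X, Real.exp (4 * (ρ X + 2 * a)) - 1 ≤ α'') (hsp : ∀ X, CplxRegTube N lo hi a α' α'' ⊆ sp X) :
    LineInStrip sp' sp (expLine gen (fun _ _ _ => 1)) (fun X => a / κ X) :=
  fun X φ hφ _ hζ => hsp X (expLine_mem_cplxRegTube (hgen X φ hφ) (htr X φ hφ) (hκ X) (hbound X φ hφ) (hρ X)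
    (hsmall X φ hφ) ha (h4 X) (h3 X) hζ)

end cplxregtube

/-! ## §4. THE LOCATED JOINT THEOREM: (26) AND holomorphy on the COMPLEX-REGULAR configurations only -/

section joint

variable (N : ℕ) [NeZero N] {d : ℕ} {lo hi : LSite d} {D : LocDomainSys}

attribute [local instance] B10Eq29TubeLine.cstarAlgebraMatrix

/-- `M_N(ℂ)`. -/
local notation "M[" N "]" => Matrix (Fin N) (Fin N) ℂ

/-- **(32) ON THE BOX FROM (26) NEAR `1` AND HOLOMORPHY ON THE COMPLEX-REGULAR TUBE**: if every analyticity space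
`sp X` contains `CplxRegTube N lo hi a α′ α″` (`a > 0`, `α′ ≥ 0`, `α″ > 0`) — a neighbourhood of the flat
configuration (§2) — and `E X` is differentiable on `sp X`, then binder (a) holds at the base point `1` and gen 30's
§4 (`derivZeroAlongV_of_suInvariantNear_of_differentiableAt`, BY NAME) applies. [cite: Balaban1985UV3, (31)–(32)
p.264; Balaban1987RG1, (1.11)–(1.14) p.262] -/
theorem derivZeroAlongV_of_suInvariantNear_cplxRegTube {a α' α'' : ℝ} (ha : 0 < a) (hα' : 0 ≤ α') (hα'' : 0 < α'')
    {E : D.Dom → (BoxBond lo hi → M[N]) → ℂ} {sp sp' : D.Dom → Set (BoxBond lo hi → M[N])}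
    {gen : D.Dom → (BoxBond lo hi → M[N]) → BoxBond lo hi → M[N]}
    (hsp : ∀ X, CplxRegTube N lo hi a α' α'' ⊆ sp X) (hE : ∀ X, DifferentiableOn ℂ (E X) (sp X)) {δ : ℝ}
    (hδ : 0 < δ)
    (hconj : ∀ X, ∀ W ∈ Matrix.specialUnitaryGroup (Fin N) ℂ, ∀ V : BoxBond lo hi → M[N],
      (∀ b, V b ∈ Matrix.specialUnitaryGroup (Fin N) ℂ) → (∀ b, ‖V b - 1‖ < δ) →
        E X (fun b => W * V b * star W) = E X V)
    (htr : ∀ X φ, φ ∈ sp' X → ∀ b, Matrix.trace (gen X φ b) = 0) :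
    DerivZeroAlongV sp' E (expLine gen (fun _ _ _ => 1)) :=
  derivZeroAlongV_of_suInvariantNear_of_differentiableAt N
    (fun X => differentiableAt_comp_expChart_zero_of_mem_nhds (base₀ := fun _ _ => (1 : M[N]))
      (mem_of_superset (cplxRegTube_mem_nhds_one ha hα' hα'') (hsp X)) (hE X)) hδ hconj htr

/-- **THE LOCATED JOINT THEOREM, `G = SU(N)` — (26) ON THE REGULAR CONFIGURATIONS AND HOLOMORPHY ON THE
COMPLEX-REGULAR TUBE ONLY, i.e. on the model of [I]'s analyticity space in ALL THREE CONDITIONS (i)–(iii) on `𝐔`.**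
Gen 30's `logHalfBound_sub_box_of_regTube` with its holomorphy hypothesis `RegTube N lo hi a α′ ⊆ sp X` REPLACED by
`CplxRegTube N lo hi a α′ α″ ⊆ sp X`, at the price of ONE more smallness binder `e^{8(R X·α + a)} − 1 ≤ α″` (the strip
curve `ζ ↦ exp(ζ·gen)·1`, `‖gen‖ ≤ 2 R X α` (gen 27), `ζ ∈ Rect (a/κ)`, then also satisfies (iii): §3) next to gen
30's `8(R X·α) + 4a ≤ α′`; binder (a) comes from the complex-regular tube being a neighbourhood of `1` (§2, §4), and
everything else — (29) = gen 28's `eq29_axialBox_reg`, (26) near `1` = gen 28's `conjInvNear_of_orbitConstOnIn_regSU`,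
the engine = gen 17's `logHalfBound_diffAlongV_of_derivZero` — is invoked BY NAME with gen 30's binders VERBATIM.  FOUR
SCALES of print are visible: `α` ((13), the evaluated configurations) `≤ α′` ((i) (1.11): `α₀ξ²`), `α″` ((iii)
(1.14): the SAME `α₀ξ²` in print; at `α″ = α′` both smallness binders are met by small `R X·α` and `a`, example
below), and the generator size `2 R X α` ((28)) in between. [cite: Balaban1985UV3, (26) p.263, p.264 («(26) holds for
all regular gauge field configurations»), (27)–(29) p.263, (31)–(32) p.264, p.263 («The third property is the
analyticity with respect to U₁»); Balaban1987RG1, (1.11)–(1.14) p.262, p.263 («We assume that the function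
𝐄⁽ʲ⁾(X, g_{j−1}, 𝐔, 𝐉) is defined and analytic on the space Uᶜⱼ(X, α₀, α₁)»)] -/
theorem logHalfBound_sub_box_of_cplxRegTube {B r a p q : ℝ} (ha : 0 < a) (hp : 0 ≤ p) (hq : 0 ≤ q)
    (hpq : 0 < p + q) (hB : 0 ≤ B) (y : D.Dom → LSite d) (hy : ∀ X, InBox lo hi (y X)) (R : D.Dom → ℕ)
    {α α' α'' : ℝ} (hα : 0 ≤ α) (hα' : 0 < α') (hα'' : 0 < α'') (hαα' : α ≤ α') (hR4 : ∀ X, (R X : ℝ) * α ≤ 1 / 4)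
    (hRπ : ∀ X, (N : ℝ) * ((R X : ℝ) * α) < Real.pi) (hRpq : ∀ X, 2 * ((R X : ℝ) * α) ≤ p + q * (1 + D.dj X))
    (hsmall : ∀ X, 8 * ((R X : ℝ) * α) + 4 * a ≤ α') (hsmall2 : ∀ X, Real.exp (8 * ((R X : ℝ) * α + a)) - 1 ≤ α'')
    {E : D.Dom → (BoxBond lo hi → M[N]) → ℂ} {sp' sp : D.Dom → Set (BoxBond lo hi → M[N])}
    {dep : D.Dom → Set (BoxBond lo hi)} {nX : D.Dom → ℕ}
    (hsp : ∀ X, CplxRegTube N lo hi a α' α'' ⊆ sp X) (hE : ∀ X, DifferentiableOn ℂ (E X) (sp X))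
    (h26 : ∀ X, OrbitConstOnIn (boxEnds lo hi) (specialUnitaryUnits (Fin N)) (E X) (regSU N lo hi α'))
    (hEb : B13.LogHalfBound D sp E nX B r)
    (hloc : ∀ X (V V' : BoxBond lo hi → M[N]), (∀ b ∈ dep X, V b = V' b) → E X V = E X V')
    (hSU : ∀ X φ, φ ∈ sp' X → ∀ b, φ b ∈ Matrix.specialUnitaryGroup (Fin N) ℂ)
    (h13 : ∀ X φ, φ ∈ sp' X → ∀ (x : LSite d) (κ μ : Fin d), κ ≠ μ → PlaqIn lo hi (x, κ, μ) →
      ‖plaq (extCfg lo hi φ) x κ μ - 1‖ ≤ α)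
    (hdep : ∀ X, ∀ b ∈ dep X, l1 (b.1.1 - y X) ≤ R X) :
    B13.LogHalfBound D sp' (fun X φ => E X φ - E X (fun _ => 1)) nX (8 * ((p + q) / a) ^ 2 * B) (r - 2) := by
  have hU : ∀ X φ, φ ∈ sp' X → ∀ b, φ b ∈ unitary M[N] :=
    fun X φ hφ b => (Matrix.mem_specialUnitaryGroup_iff.mp (hSU X φ hφ b)).1
  have hgen : ∀ X φ, φ ∈ sp' X → ∀ b, star (axialGenBox lo hi y R X φ b) = -axialGenBox lo hi y R X φ b :=
    fun X φ hφ b => skewAdjoint.mem_iff.mp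
      (axialGenBox_mem_skewAdjoint y R (hy X) (hU X φ hφ) (h13 X φ hφ) hα (hR4 X) b)
  have hρ : ∀ X φ, φ ∈ sp' X → ∀ b, ‖axialGenBox lo hi y R X φ b‖ ≤ 2 * ((R X : ℝ) * α) :=
    fun X φ hφ b => norm_axialGenBox_le y R (hy X) (hU X φ hφ) (h13 X φ hφ) hα ((hR4 X).trans (by norm_num)) b
  have hbound : ∀ X φ, φ ∈ sp' X → ∀ b, ‖axialGenBox lo hi y R X φ b‖ ≤ p + q * (1 + D.dj X) :=
    fun X φ hφ b => (hρ X φ hφ b).trans (hRpq X)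
  have htr : ∀ X φ, φ ∈ sp' X → ∀ b, Matrix.trace (axialGenBox lo hi y R X φ b) = 0 :=
    fun X φ hφ b => trace_axialGenBox_eq_zero N y R (hy X) (hSU X φ hφ) (h13 X φ hφ) hα (hR4 X) (hRπ X) b
  have hκ : ∀ X, 0 < p + q * (1 + D.dj X) := fun X => by
    have hd := D.dj_nonneg X
    nlinarith [mul_nonneg hq hd]
  have hh : ∀ X, 0 < a / (p + q * (1 + D.dj X)) := fun X => div_pos ha (hκ X)
  have hH : ∀ X, (a / (p + q * (1 + D.dj X)))⁻¹ ≤ (p + q) / a * (1 + D.dj X) := fun X =>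
    inv_halfWidth_le ha hp (D.dj_nonneg X)
  have hρ0 : ∀ X, 0 ≤ 2 * ((R X : ℝ) * α) := fun X => by positivity
  have h4 : ∀ X, 4 * (2 * ((R X : ℝ) * α) + a) ≤ α' := fun X => by linarith [hsmall X]
  have h3 : ∀ X, Real.exp (4 * (2 * ((R X : ℝ) * α) + 2 * a)) - 1 ≤ α'' := fun X => by
    rw [show 4 * (2 * ((R X : ℝ) * α) + 2 * a) = 8 * ((R X : ℝ) * α + a) by ring]
    exact hsmall2 X
  have hdom : LineInStrip sp' sp (expLine (axialGenBox lo hi y R) (fun _ _ _ => 1))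
      (fun X => a / (p + q * (1 + D.dj X))) :=
    lineInStrip_expLine_cplxRegTube hgen htr hκ hbound hρ0 hρ ha.le h4 h3 hsp
  have han : AnalyticOnStrip sp' E (expLine (axialGenBox lo hi y R) (fun _ _ _ => 1))
      (fun X => a / (p + q * (1 + D.dj X))) := analyticOnStrip_expLine hE hdom
  have h0 : DerivZeroAlongV sp' E (expLine (axialGenBox lo hi y R) (fun _ _ _ => 1)) :=
    derivZeroAlongV_of_suInvariantNear_cplxRegTube N ha hα'.le hα'' hsp hE (by positivity : 0 < α' / 4)
      (fun X => conjInvNear_of_orbitConstOnIn_regSU (h26 X) hα') htr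
  have h29 := eq29_axialBox_reg N y hy R hα hαα' (fun X => lt_of_le_of_lt (hR4 X) (by norm_num)) hloc h26 hSU h13
    hdep
  exact logHalfBound_congr (diffAlongV_eq_sub h29) (logHalfBound_diffAlongV_of_derivZero hh hH hB hdom han h0 hEb)

/-- **GEN 30's HYPOTHESES PLUS THE SECOND SMALLNESS GIVE THE LOCATED ONES**: holomorphy on the regular tube implies it
on the complex-regular tube (§2 `cplxRegTube_subset_regTube`), so under `e^{8(R X·α + a)} − 1 ≤ α″` gen 30's binder
list yields the conclusion through the located theorem (gen 30's own theorem needs no `α″`). [folklore] -/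
example {B r a p q : ℝ} (ha : 0 < a) (hp : 0 ≤ p) (hq : 0 ≤ q)
    (hpq : 0 < p + q) (hB : 0 ≤ B) (y : D.Dom → LSite d) (hy : ∀ X, InBox lo hi (y X)) (R : D.Dom → ℕ)
    {α α' α'' : ℝ} (hα : 0 ≤ α) (hα' : 0 < α') (hα'' : 0 < α'') (hαα' : α ≤ α') (hR4 : ∀ X, (R X : ℝ) * α ≤ 1 / 4)
    (hRπ : ∀ X, (N : ℝ) * ((R X : ℝ) * α) < Real.pi) (hRpq : ∀ X, 2 * ((R X : ℝ) * α) ≤ p + q * (1 + D.dj X))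
    (hsmall : ∀ X, 8 * ((R X : ℝ) * α) + 4 * a ≤ α') (hsmall2 : ∀ X, Real.exp (8 * ((R X : ℝ) * α + a)) - 1 ≤ α'')
    {E : D.Dom → (BoxBond lo hi → M[N]) → ℂ} {sp' sp : D.Dom → Set (BoxBond lo hi → M[N])}
    {dep : D.Dom → Set (BoxBond lo hi)} {nX : D.Dom → ℕ}
    (hsp : ∀ X, RegTube N lo hi a α' ⊆ sp X) (hE : ∀ X, DifferentiableOn ℂ (E X) (sp X))
    (h26 : ∀ X, OrbitConstOnIn (boxEnds lo hi) (specialUnitaryUnits (Fin N)) (E X) (regSU N lo hi α'))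
    (hEb : B13.LogHalfBound D sp E nX B r)
    (hloc : ∀ X (V V' : BoxBond lo hi → M[N]), (∀ b ∈ dep X, V b = V' b) → E X V = E X V')
    (hSU : ∀ X φ, φ ∈ sp' X → ∀ b, φ b ∈ Matrix.specialUnitaryGroup (Fin N) ℂ)
    (h13 : ∀ X φ, φ ∈ sp' X → ∀ (x : LSite d) (κ μ : Fin d), κ ≠ μ → PlaqIn lo hi (x, κ, μ) →
      ‖plaq (extCfg lo hi φ) x κ μ - 1‖ ≤ α)
    (hdep : ∀ X, ∀ b ∈ dep X, l1 (b.1.1 - y X) ≤ R X) :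
    B13.LogHalfBound D sp' (fun X φ => E X φ - E X (fun _ => 1)) nX (8 * ((p + q) / a) ^ 2 * B) (r - 2) :=
  logHalfBound_sub_box_of_cplxRegTube N ha hp hq hpq hB y hy R hα hα' hα'' hαα' hR4 hRπ hRpq hsmall hsmall2
    (fun X => cplxRegTube_subset_regTube.trans (hsp X)) hE h26 hEb hloc hSU h13 hdep

/-- Sanity: gen 30's theorem BY NAME, same binders WITHOUT `α″` (the two theorems are incomparable: gen 30 assumes
more holomorphy and one smallness binder fewer). [folklore] -/
example {B r a p q : ℝ} (ha : 0 < a) (hp : 0 ≤ p) (hq : 0 ≤ q)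
    (hpq : 0 < p + q) (hB : 0 ≤ B) (y : D.Dom → LSite d) (hy : ∀ X, InBox lo hi (y X)) (R : D.Dom → ℕ) {α α' : ℝ}
    (hα : 0 ≤ α) (hα' : 0 < α') (hαα' : α ≤ α') (hR4 : ∀ X, (R X : ℝ) * α ≤ 1 / 4)
    (hRπ : ∀ X, (N : ℝ) * ((R X : ℝ) * α) < Real.pi) (hRpq : ∀ X, 2 * ((R X : ℝ) * α) ≤ p + q * (1 + D.dj X))
    (hsmall : ∀ X, 8 * ((R X : ℝ) * α) + 4 * a ≤ α')
    {E : D.Dom → (BoxBond lo hi → M[N]) → ℂ} {sp' sp : D.Dom → Set (BoxBond lo hi → M[N])}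
    {dep : D.Dom → Set (BoxBond lo hi)} {nX : D.Dom → ℕ}
    (hsp : ∀ X, RegTube N lo hi a α' ⊆ sp X) (hE : ∀ X, DifferentiableOn ℂ (E X) (sp X))
    (h26 : ∀ X, OrbitConstOnIn (boxEnds lo hi) (specialUnitaryUnits (Fin N)) (E X) (regSU N lo hi α'))
    (hEb : B13.LogHalfBound D sp E nX B r)
    (hloc : ∀ X (V V' : BoxBond lo hi → M[N]), (∀ b ∈ dep X, V b = V' b) → E X V = E X V')
    (hSU : ∀ X φ, φ ∈ sp' X → ∀ b, φ b ∈ Matrix.specialUnitaryGroup (Fin N) ℂ)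
    (h13 : ∀ X φ, φ ∈ sp' X → ∀ (x : LSite d) (κ μ : Fin d), κ ≠ μ → PlaqIn lo hi (x, κ, μ) →
      ‖plaq (extCfg lo hi φ) x κ μ - 1‖ ≤ α)
    (hdep : ∀ X, ∀ b ∈ dep X, l1 (b.1.1 - y X) ≤ R X) :
    B13.LogHalfBound D sp' (fun X φ => E X φ - E X (fun _ => 1)) nX (8 * ((p + q) / a) ^ 2 * B) (r - 2) :=
  logHalfBound_sub_box_of_regTube N ha hp hq hpq hB y hy R hα hα' hαα' hR4 hRπ hRpq hsmall hsp hE h26 hEb hloc hSU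
    h13 hdep

/-- **THE NUMERIC BINDERS ARE JOINTLY SATISFIABLE WITH ALL WINDOWS POSITIVE AND `α″ = α′`** (print's regime: the same
constant `α₀ξ²` in (1.11) and (1.14)): e.g. `α′ = α″ = 1`, `a = 1/64`, `α = 1/(64N)`, `R ≡ 1`, `p = q = 1` — then
`R·α ≤ 1/4`, `N·R·α = 1/64 < π`, `8Rα + 4a ≤ 1`, and `e^{8(Rα + a)} − 1 ≤ e^{1/4} − 1 ≤ 1/2 ≤ 1`. [folklore] -/
example : (0 : ℝ) ≤ 1 / (64 * N) ∧ (1 / (64 * N) : ℝ) ≤ 1 ∧ (∀ _X : D.Dom, (1 : ℝ) * (1 / (64 * N)) ≤ 1 / 4) ∧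
    (∀ _X : D.Dom, (N : ℝ) * ((1 : ℝ) * (1 / (64 * N))) < Real.pi) ∧
    (∀ X : D.Dom, 2 * ((1 : ℝ) * (1 / (64 * N))) ≤ 1 + 1 * (1 + D.dj X)) ∧
    (∀ _X : D.Dom, 8 * ((1 : ℝ) * (1 / (64 * N))) + 4 * (1 / 64 : ℝ) ≤ 1) ∧
    (∀ _X : D.Dom, Real.exp (8 * ((1 : ℝ) * (1 / (64 * N)) + 1 / 64)) - 1 ≤ 1) := by
  have hN : (1 : ℝ) ≤ N := by exact_mod_cast NeZero.one_le
  have hN0 : (N : ℝ) ≠ 0 := Nat.cast_ne_zero.mpr (NeZero.ne N)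
  have h1 : (1 / (64 * N) : ℝ) ≤ 1 / 64 := one_div_le_one_div_of_le (by norm_num) (by linarith)
  have h2 : (N : ℝ) * ((1 : ℝ) * (1 / (64 * N))) = 1 / 64 := by
    field_simp
  refine ⟨by positivity, h1.trans (by norm_num), fun _ => by linarith, fun _ => by
    rw [h2]; linarith [Real.pi_gt_three], fun X => by linarith [D.dj_nonneg X], fun _ => by linarith, fun _ => ?_⟩
  have hy0 : 0 ≤ 8 * ((1 : ℝ) * (1 / (64 * N)) + 1 / 64) := by positivity
  have hy : 8 * ((1 : ℝ) * (1 / (64 * N)) + 1 / 64) ≤ 1 / 4 := by linarith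
  have he := Real.abs_exp_sub_one_le (x := 8 * ((1 : ℝ) * (1 / (64 * N)) + 1 / 64))
    (by rw [abs_of_nonneg hy0]; linarith)
  rw [abs_of_nonneg hy0] at he
  linarith [le_abs_self (Real.exp (8 * ((1 : ℝ) * (1 / (64 * N)) + 1 / 64)) - 1)]

end joint

/-! ## §5. TEETH: CONDITION (iii) IS A NON-TRIVIAL CUT OF THE REGULAR TUBE — scalar dilation of one bond -/

section teeth

variable (N : ℕ) [NeZero N]

attribute [local instance] B10Eq29TubeLine.cstarAlgebraMatrix

/-- `M_N(ℂ)`. -/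
local notation "M[" N "]" => Matrix (Fin N) (Fin N) ℂ

omit [NeZero N] in
/-- `e^c·1 = exp (c·1)` in `M_N(ℂ)` (cf. the lineage's `BlockAveragingFederbushRadius.cexp_smul_one`). [folklore] -/
theorem cexp_smul_one (c : ℂ) : Complex.exp c • (1 : M[N]) = exp (c • (1 : M[N])) := by
  rw [← Algebra.algebraMap_eq_smul_one, ← Algebra.algebraMap_eq_smul_one, Complex.exp_eq_exp_ℂ]
  exact algebraMap_exp_comm (𝔸 := M[N]) c

/-- `‖exp (t·1) − 1‖ = |e^t − 1|` in `M_N(ℂ)` (`N ≥ 1`, `t` real). [folklore] -/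
theorem norm_exp_ofReal_smul_one_sub_one (t : ℝ) : ‖exp ((t : ℂ) • (1 : M[N])) - 1‖ = |Real.exp t - 1| := by
  rw [← cexp_smul_one, show Complex.exp t • (1 : M[N]) - 1 = (Complex.exp t - 1) • (1 : M[N]) by
    rw [sub_smul, one_smul], norm_smul, CStarRing.norm_one, mul_one, ← Complex.ofReal_exp, ← Complex.ofReal_one,
    ← Complex.ofReal_sub, Complex.norm_real, Real.norm_eq_abs]

/-- **The logarithm of the scalar dilation**: `B = t·1` on the bond `b₀ = ⟨(0,0), e₀⟩` of the unit square `[0,1]² ⊂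
ℤ²`, `0` elsewhere. [folklore] -/
noncomputable def dilB (t : ℝ) : BoxBond (0 : LSite 2) 1 → M[N] :=
  fun b => if (b : LSite 2 × Fin 2) = ((0 : LSite 2), (0 : Fin 2)) then (t : ℂ) • (1 : M[N]) else 0

/-- **THE SCALAR DILATION OF ONE BOND**: the configuration `exp(t·1) = e^t·1` on `b₀`, `1` elsewhere — a point of
the tube over the FLAT base `U ≡ 1` (`B = dilB t`), `Gᶜ = SL`-valued only for `t = 0` but in `M_N(ℂ)` (the model's
fibre, HONEST SCOPE) a legitimate complex configuration with `‖B‖ = |t|`. [folklore] -/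
noncomputable def dilV (t : ℝ) : BoxBond (0 : LSite 2) 1 → M[N] :=
  fun b => exp (dilB N t b) * 1

/-- `‖dilB t b‖ ≤ |t|`. [folklore] -/
theorem norm_dilB_le (t : ℝ) (b : BoxBond (0 : LSite 2) 1) : ‖dilB N t b‖ ≤ |t| := by
  unfold dilB
  split_ifs
  · rw [norm_smul, CStarRing.norm_one, mul_one, Complex.norm_real, Real.norm_eq_abs]
  · rw [norm_zero]
    exact abs_nonneg t

/-- The scalar dilation lies in the regular tube as soon as `|t| < a` (`α′ ≥ 0`; its base is flat). [folklore] -/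
theorem dilV_mem_regTube {t a α' : ℝ} (hta : |t| < a) (hα' : 0 ≤ α') :
    dilV N t ∈ RegTube N (0 : LSite 2) 1 a α' :=
  exp_mul_mem_regTube (fun b => (norm_dilB_le N t b).trans_lt hta) (one_mem_regSU hα')

omit [NeZero N] in
/-- The extension of the scalar dilation to all bonds of `ℤ²`: `exp(t·1)` on `b₀`, `1` elsewhere. [folklore] -/
theorem extCfg_dilV (t : ℝ) (b : LSite 2 × Fin 2) :
    extCfg 0 1 (dilV N t) b = if b = ((0 : LSite 2), (0 : Fin 2)) then exp ((t : ℂ) • (1 : M[N])) else 1 := by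
  by_cases hb : InBox (0 : LSite 2) 1 b.1 ∧ InBox (0 : LSite 2) 1 (b.1 + e b.2)
  · rw [show extCfg 0 1 (dilV N t) b = dilV N t ⟨b, hb⟩ from extCfg_coe (dilV N t) ⟨b, hb⟩]
    unfold dilV dilB
    by_cases h : b = ((0 : LSite 2), (0 : Fin 2))
    · rw [if_pos h, if_pos h, mul_one]
    · rw [if_neg h, if_neg h, mul_one, NormedSpace.exp_zero]
  · rw [extCfg_of_not _ hb, if_neg]
    rintro rfl
    exact hb ⟨inBox_sq_zero, inBox_sq_e 0⟩

omit [NeZero N] in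
/-- **The plaquette variable (with inverses) of the scalar dilation is `exp(t·1) = e^t·1`.** [folklore] -/
theorem plaqInv_dilV (t : ℝ) : plaqInv (extCfg 0 1 (dilV N t)) 0 0 1 = exp ((t : ℂ) • (1 : M[N])) := by
  have h01 : ((0 : LSite 2) + e 0, (1 : Fin 2)) ≠ ((0 : LSite 2), (0 : Fin 2)) := fun h => by
    have := congrArg Prod.snd h
    exact absurd this (by decide)
  have h10 : ((0 : LSite 2) + e 1, (0 : Fin 2)) ≠ ((0 : LSite 2), (0 : Fin 2)) := fun h => by
    have h' := congrFun (congrArg Prod.fst h) 1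
    simp [e] at h'
  have h1 : ((0 : LSite 2), (1 : Fin 2)) ≠ ((0 : LSite 2), (0 : Fin 2)) := fun h => by
    have := congrArg Prod.snd h
    exact absurd this (by decide)
  rw [plaqInv, extCfg_dilV, extCfg_dilV, extCfg_dilV, extCfg_dilV, if_pos rfl, if_neg h01, if_neg h10, if_neg h1,
    Ring.inverse_one, mul_one, mul_one, mul_one]

/-- **The scalar dilation VIOLATES (iii) once `|e^t − 1| > α″`.** [folklore] -/
theorem dilV_not_mem_regCplx {t α'' : ℝ} (h : α'' < |Real.exp t - 1|) :
    dilV N t ∉ RegCplx (0 : LSite 2) 1 α'' := fun hV => by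
  have h1 := hV 0 0 1 (by decide) ⟨inBox_sq_zero, inBox_sq_ee⟩
  rw [plaqInv_dilV, norm_exp_ofReal_smul_one_sub_one] at h1
  exact absurd h1 (not_le.mpr h)

/-- **CONDITION (iii) IS A NON-TRIVIAL CUT OF THE REGULAR TUBE — THE LOWER END OF THE BRACKET**: for every `a > 0`,
`α′ ≥ 0` and every `α″ < e^a − 1` there is a point of gen 30's regular tube `RegTube N 0 1 a α′` (unit square of
`ℤ²`, `N ≥ 1`) OUTSIDE the complex-regular tube `CplxRegTube N 0 1 a α′ α″`: the scalar dilation `e^t·1` of one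
bond with `|t| < a` and `e^t − 1 > α″` (its plaquette variable is `e^t·1`).  Together with §2's
`cplxRegTube_eq_regTube` (`α″ ≥ α′ + e^{4a} − 1` ⇒ no cut) this brackets the threshold; in print's regime `α″ = α′`
and `e^a − 1 > α′` (large `B`-window relative to the plaquette window) the cut is PROPER. [folklore] -/
theorem exists_mem_regTube_not_mem_cplxRegTube {a α' α'' : ℝ} (ha : 0 < a) (hα' : 0 ≤ α')
    (h : α'' < Real.exp a - 1) :
    ∃ V ∈ RegTube N (0 : LSite 2) 1 a α', V ∉ CplxRegTube N 0 1 a α' α'' := by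
  by_cases h0 : α'' < 0
  · refine ⟨dilV N (a / 2), dilV_mem_regTube N (by rw [abs_of_pos (half_pos ha)]; exact half_lt_self ha) hα',
      fun hV => dilV_not_mem_regCplx N (h0.trans_le (abs_nonneg _)) hV.2⟩
  · have h0' : 0 ≤ α'' := not_lt.mp h0
    set t : ℝ := (Real.log (1 + α'') + a) / 2 with ht
    have hlog : Real.log (1 + α'') < a := by
      rw [Real.log_lt_iff_lt_exp (by linarith)]
      linarith
    have hlog0 : 0 ≤ Real.log (1 + α'') := Real.log_nonneg (by linarith)
    have ht0 : 0 < t := by rw [ht]; positivity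
    have hta : t < a := by rw [ht]; linarith
    have htl : Real.log (1 + α'') < t := by rw [ht]; linarith
    have hexp : α'' < Real.exp t - 1 := by
      have := Real.exp_lt_exp.mpr htl
      rw [Real.exp_log (by linarith)] at this
      linarith
    refine ⟨dilV N t, dilV_mem_regTube N (by rwa [abs_of_pos ht0]) hα', fun hV =>
      dilV_not_mem_regCplx N ?_ hV.2⟩
    rwa [abs_of_pos (by linarith [Real.add_one_le_exp t] : 0 < Real.exp t - 1)]

/-- In particular, in print's regime `α″ = α′ < e^a − 1` the complex-regular tube is a PROPER subset of the regular
tube. [folklore] -/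
theorem cplxRegTube_ssubset_regTube {a α' : ℝ} (ha : 0 < a) (hα' : 0 ≤ α') (h : α' < Real.exp a - 1) :
    CplxRegTube N (0 : LSite 2) 1 a α' α' ⊂ RegTube N 0 1 a α' := by
  obtain ⟨V, hV, hV'⟩ := exists_mem_regTube_not_mem_cplxRegTube N ha hα' h
  exact ssubset_of_subset_not_subset cplxRegTube_subset_regTube fun hs => hV' (hs hV)

/-- **THE LOCATED (26) WITH HOLOMORPHY ON THE COMPLEX-REGULAR TUBE IS STRICTLY WEAKER THAN THE GLOBAL (26)** — gen
30's witness `located26_strictly_weaker_on_regTube` restricted (`DifferentiableOn.mono`, §2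
`cplxRegTube_subset_regTube`): a function differentiable on the whole complex-regular tube, orbit-constant on `regSU`,
not `SiteGaugeInvSU` (`a > 0`, `0 ≤ α′`, `α′ + 4(e^a − 1) < |e^{2πi/N} − 1|`, any `α″`). [folklore] -/
theorem located26_strictly_weaker_on_cplxRegTube {a α' α'' : ℝ} (ha : 0 < a) (h0 : 0 ≤ α')
    (h : α' + 4 * (Real.exp a - 1) < ‖Complex.exp (thetaN N) - 1‖) :
    ∃ F : (BoxBond (0 : LSite 2) 1 → M[N]) → ℂ,
      DifferentiableOn ℂ F (CplxRegTube N 0 1 a α' α'') ∧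
        OrbitConstOnIn (boxEnds 0 1) (specialUnitaryUnits (Fin N)) F (regSU N 0 1 α') ∧
          ¬ SiteGaugeInvSU (boxEnds 0 1) F := by
  obtain ⟨F, hF, h26, hn⟩ := located26_strictly_weaker_on_regTube N ha h0 h
  exact ⟨F, hF.mono cplxRegTube_subset_regTube, h26, hn⟩

/-- So for `N ≥ 2` the strict-weakness witness exists for SOME positive windows `a, α′` and EVERY `α″` (gen 30's
`exists_windows` with gen 28's `norm_exp_thetaN_sub_one_pos`). [folklore] -/
example (hN : 2 ≤ N) (α'' : ℝ) : ∃ a α' : ℝ, 0 < a ∧ 0 < α' ∧ ∃ F : (BoxBond (0 : LSite 2) 1 → M[N]) → ℂ,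
    DifferentiableOn ℂ F (CplxRegTube N 0 1 a α' α'') ∧
      OrbitConstOnIn (boxEnds 0 1) (specialUnitaryUnits (Fin N)) F (regSU N 0 1 α') ∧
        ¬ SiteGaugeInvSU (boxEnds 0 1) F := by
  obtain ⟨a, α', ha, hα', h⟩ := exists_windows (norm_exp_thetaN_sub_one_pos N hN)
  exact ⟨a, α', ha, hα', located26_strictly_weaker_on_cplxRegTube N ha hα'.le h⟩

end teeth

end Literature.MathematicalPhysics.QuantumFieldTheory.Balaban1983to89.B10Eq28CplxRegTube
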